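import Literature.NumberTheory.Transcendental.HyperlogarithmsAtOneFamilies
import HarnessLib

/-!
# Hyperlogarithms on `(0,1)`, XIII: Theorem F₁ for general alphabets and for families

Thirteenth layer of the analytic road to `GenusZeroPeriodsMZV` (Brown 2009): the generalisation of
layer VII (Theorem F₁ for the alphabet `{0,1}`) to an arbitrary finite admissible alphabet
`{0, 1, σ_c ≥ 1}`, with coefficients that may be FUNCTIONS OF PARAMETERS — the form needed for the
fibration argument of §8.3 in cubical coordinates, where the letters seen by one variable depend on
the remaining ones.

* The class `ℝ[t, t⁻¹, (σ_a - t)⁻¹] ⊗ ℝ⟨words⟩` (`GB`, `bvalG`, `GH`, `hevG`): multiplication table by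
  the densities (`mulG`, division and partial fractions, generic over a ring of coefficients with
  an inverse), primitives inside the class (`primBG`, `primG`, `hasDerivAt_hevG_primG`), regularised
  values at `0⁺` (`val0`, `reg0G`, through the power-series coefficients of layer VI) and at `1⁻`
  (`val1`, `reg1G`, through the logarithmic expansion at the top of layer IX), and
  `integral_hevG_eq`: `∫₀¹ hevG F = reg1G (primG F) - reg0G (primG F)` for integrable `hevG F`.
* Families (`σat σA r`, the alphabet at the parameter `r`): evaluation commutes with all the
  tables under uniform zero/coincidence patterns (`evF_mulG`, `evF_primG`); all coefficients
  produced lie in any `ℚ`-subalgebra `𝒢` of functions of the parameters containing the letters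
  `σ_a`, the `1/σ_a` and the `1/(σ_c - σ_a)` (`coefIn_primG`, `coeff_mem`, `val0_mem`,
  `coefIn_topA` through the mirror `topA` of the top coefficients of layer IX with
  `topCoeff_cons_eq`/`evT_topA`, `coefIn_val1A`).
* `Hyperlog.integral_hevG_family` (**Theorem F₁ for families**):
  `∫₀¹ hevG(σ_r)(F r) = Σ_w (outA F)_w(r) · L_w(1; σ_r)` with `outA F` having coefficients in `𝒢`
  (`coefIn_outA`) and words of length `≤ maxLenG F + 1` in the supports of the shuffle
  regularisations `reg_{z,o} V` (`outA_support`), i.e. doubly regular — ready for the expansion of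
  the `L_w(1; σ_r)` as hyperlogarithms in the next variable (layer XII).

No named fact is introduced.

## References

* F. C. S. Brown, *Multiple zeta values and periods of moduli spaces `𝔐̄_{0,n}`*, Ann. Sci. Éc.
  Norm. Supér. (4) 42 (2009), 371–489, §4.3, §5.2, §6.3–6.5 (Thm 6.25), §8.3.
  doi:10.24033/asens.2099. [BrownENS2009]
-/

noncomputable section

open MeasureTheory intervalIntegral Set Filter
open scoped BigOperators Topology

namespace Literature.NumberTheory.Transcendental

namespace Hyperlog

variable {α : Type*}

/-! ### The basis `t^k, t^{-k-1}, (σ_a - t)^{-k-1}` and its tables -/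

section GBasis

/-- Basis of `ℝ[t, t⁻¹, (σ_a - t)⁻¹]`: `pow k = t^k`, `invPow k = t^{-(k+1)}`,
`invLet a k = (σ_a - t)^{-(k+1)}`. [folklore] -/
inductive GB (α : Type*)
  | pow (k : ℕ)
  | invPow (k : ℕ)
  | invLet (a : α) (k : ℕ)
  deriving DecidableEq

variable (σ : α → ℝ)

/-- The basis functions. [folklore] -/
def bvalG : GB α → ℝ → ℝ
  | GB.pow k, t => t ^ k
  | GB.invPow k, t => (t ^ (k + 1))⁻¹
  | GB.invLet a k, t => ((σ a - t) ^ (k + 1))⁻¹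

/-- Evaluation of a formal `ℝ`-combination of basis functions. [folklore] -/
def bevG (f : GB α →₀ ℝ) (t : ℝ) : ℝ := f.sum fun β r => r * bvalG σ β t

/-- `bevG` is additive. [folklore] -/
theorem bevG_add (f g : GB α →₀ ℝ) (t : ℝ) : bevG σ (f + g) t = bevG σ f t + bevG σ g t := by
  unfold bevG; rw [Finsupp.sum_add_index'] <;> intros <;> simp [add_mul]

/-- `bevG` of a single. [folklore] -/
@[simp] theorem bevG_single (β : GB α) (r t : ℝ) : bevG σ (Finsupp.single β r) t = r * bvalG σ β t := by
  unfold bevG; rw [Finsupp.sum_single_index]; simp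

/-- `bevG 0 = 0`. [folklore] -/
@[simp] theorem bevG_zero (t : ℝ) : bevG σ 0 t = 0 := by simp [bevG]

/-- `bevG` as an additive homomorphism. [folklore] -/
def bevGHom (t : ℝ) : (GB α →₀ ℝ) →+ ℝ where
  toFun f := bevG σ f t
  map_zero' := bevG_zero σ t
  map_add' f g := bevG_add σ f g t

/-- `bevG` of a difference. [folklore] -/
theorem bevG_sub (f g : GB α →₀ ℝ) (t : ℝ) : bevG σ (f - g) t = bevG σ f t - bevG σ g t :=
  map_sub (bevGHom σ t) f g

/-- `bevG` is `ℝ`-linear (scalars). [folklore] -/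
theorem bevG_smul (r : ℝ) (f : GB α →₀ ℝ) (t : ℝ) : bevG σ (r • f) t = r * bevG σ f t := by
  unfold bevG
  rw [Finsupp.sum_smul_index' (fun _ => by simp)]
  simp only [Finsupp.sum, Finset.mul_sum, smul_eq_mul, mul_assoc]

/-- `bevG` of a finite sum. [folklore] -/
theorem bevG_finset_sum {ι : Type*} (s : Finset ι) (g : ι → GB α →₀ ℝ) (t : ℝ) :
    bevG σ (∑ i ∈ s, g i) t = ∑ i ∈ s, bevG σ (g i) t :=
  map_sum (bevGHom σ t) g s

/-- `bevG` of a `Finsupp.sum`. [folklore] -/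
theorem bevG_finsupp_sum {ι N : Type*} [Zero N] (f : ι →₀ N) (g : ι → N → GB α →₀ ℝ) (t : ℝ) :
    bevG σ (f.sum g) t = f.sum fun i n => bevG σ (g i n) t :=
  map_finsuppSum (bevGHom σ t) f g

/-- The derivative table `∂_t b_β = Σ d_{βγ} b_γ`. [folklore] -/
def dG : GB α → GB α →₀ ℝ
  | GB.pow 0 => 0
  | GB.pow (k + 1) => Finsupp.single (GB.pow k) (k + 1)
  | GB.invPow k => Finsupp.single (GB.invPow (k + 1)) (-(k + 1 : ℝ))
  | GB.invLet a k => Finsupp.single (GB.invLet a (k + 1)) (k + 1)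

variable {σ} (hσ : ∀ c, σ c = 0 ∨ 1 ≤ σ c)
include hσ

/-- `σ_a - t ≠ 0` on `(0,1)` for an admissible letter. [folklore] -/
theorem sub_ne_zero_of_adm (a : α) {t : ℝ} (ht : t ∈ Ioo (0 : ℝ) 1) : σ a - t ≠ 0 := by
  rcases hσ a with h | h
  · rw [h]; linarith [ht.1]
  · linarith [ht.2]

/-- The derivative table is correct on `(0,1)`. [folklore] -/
theorem hasDerivAt_bvalG (β : GB α) {t : ℝ} (ht : t ∈ Ioo (0 : ℝ) 1) :
    HasDerivAt (bvalG σ β) (bevG σ (dG β) t) t := by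
  have ht0 : t ≠ 0 := ht.1.ne'
  cases β with
  | pow k =>
    cases k with
    | zero =>
      show HasDerivAt (fun t : ℝ => t ^ 0) (bevG σ 0 t) t
      rw [bevG_zero]; simp only [pow_zero]; exact hasDerivAt_const t 1
    | succ k =>
      show HasDerivAt (fun t => t ^ (k + 1)) (bevG σ (Finsupp.single (GB.pow k) (k + 1)) t) t
      rw [bevG_single]
      have h := hasDerivAt_pow (k + 1) t
      simp only [Nat.add_sub_cancel] at h
      refine h.congr_deriv ?_
      simp only [bvalG]; push_cast; ring
  | invPow k =>
    show HasDerivAt (fun t => (t ^ (k + 1))⁻¹) (bevG σ (Finsupp.single (GB.invPow (k + 1)) (-(k + 1 : ℝ))) t) t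
    rw [bevG_single]
    have h := (hasDerivAt_pow (k + 1) t).inv (pow_ne_zero _ ht0)
    refine h.congr_deriv ?_
    simp only [Nat.add_sub_cancel, bvalG]
    push_cast
    field_simp
    ring
  | invLet a k =>
    have hat : σ a - t ≠ 0 := sub_ne_zero_of_adm hσ a ht
    show HasDerivAt (fun t => ((σ a - t) ^ (k + 1))⁻¹) (bevG σ (Finsupp.single (GB.invLet a (k + 1)) (k + 1)) t) t
    rw [bevG_single]
    have h1 : HasDerivAt (fun t : ℝ => (σ a - t) ^ (k + 1)) (((k + 1 : ℕ) : ℝ) * (σ a - t) ^ (k + 1 - 1) * (-1)) t :=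
      (hasDerivAt_pow (k + 1) (σ a - t)).comp t ((hasDerivAt_id t).const_sub (σ a))
    have h := h1.inv (pow_ne_zero _ hat)
    refine h.congr_deriv ?_
    simp only [Nat.add_sub_cancel, bvalG]
    push_cast
    field_simp
    ring

omit hσ in
open Classical in
/-- The multiplication table `b_β · ρ_c` (`ρ_c = 1/t` for `σ_c = 0`, `1/(σ_c - t)` otherwise), by
division and partial fractions, with coefficients in `σ_c`, `1/σ_c`, `1/(σ_c - σ_a)`; over any
commutative ring of coefficients with an inverse (the real numbers, or functions of parameters).
[folklore] -/
def mulG {K : Type*} [CommRing K] [Inv K] (σ : α → K) : GB α → α → GB α →₀ K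
  | GB.pow 0, c => if σ c = 0 then Finsupp.single (GB.invPow 0) 1 else Finsupp.single (GB.invLet c 0) 1
  | GB.pow (k + 1), c => if σ c = 0 then Finsupp.single (GB.pow k) 1
      else σ c • mulG σ (GB.pow k) c - Finsupp.single (GB.pow k) 1
  | GB.invPow 0, c => if σ c = 0 then Finsupp.single (GB.invPow 1) 1
      else (σ c)⁻¹ • (Finsupp.single (GB.invPow 0) 1 + Finsupp.single (GB.invLet c 0) 1)
  | GB.invPow (k + 1), c => if σ c = 0 then Finsupp.single (GB.invPow (k + 2)) 1
      else (σ c)⁻¹ • (Finsupp.single (GB.invPow (k + 1)) 1 + mulG σ (GB.invPow k) c)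
  | GB.invLet a 0, c => if σ c = 0 then (σ a)⁻¹ • (Finsupp.single (GB.invPow 0) 1 + Finsupp.single (GB.invLet a 0) 1)
      else if σ c = σ a then Finsupp.single (GB.invLet a 1) 1
      else (σ c - σ a)⁻¹ • (Finsupp.single (GB.invLet a 0) 1 - Finsupp.single (GB.invLet c 0) 1)
  | GB.invLet a (k + 1), c => if σ c = 0 then (σ a)⁻¹ • (mulG σ (GB.invLet a k) c + Finsupp.single (GB.invLet a (k + 1)) 1)
      else if σ c = σ a then Finsupp.single (GB.invLet a (k + 2)) 1
      else (σ c - σ a)⁻¹ • (Finsupp.single (GB.invLet a (k + 1)) 1 - mulG σ (GB.invLet a k) c)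

/-- Admissibility of a basis element: the letters of `invLet` are not at `0`. [folklore] -/
def GB.ok {K : Type*} [Zero K] (σ : α → K) : GB α → Prop
  | GB.invLet a _ => σ a ≠ 0
  | _ => True

/-- **The multiplication table is correct** on `(0,1)`: `b_β(t) ρ_c(t) = bevG (mulG β c) t`. [folklore] -/
theorem bvalG_mul_pden : ∀ (β : GB α), GB.ok σ β → ∀ (c : α) {t : ℝ}, t ∈ Ioo (0 : ℝ) 1 →
    bvalG σ β t * pden σ c t = bevG σ (mulG σ β c) t
  | GB.pow k, _, c, t, ht => by
    have ht0 : t ≠ 0 := ht.1.ne'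
    by_cases hc : σ c = 0
    · rw [pden_of_eq_zero hc ht.1]
      cases k with
      | zero => simp only [mulG, hc, if_true, bevG_single, bvalG]; field_simp; ring
      | succ k => simp only [mulG, hc, if_true, bevG_single, bvalG]; field_simp; ring
    · have hct : σ c - t ≠ 0 := sub_ne_zero_of_adm hσ c ht
      rw [pden_of_ne_zero hσ hc ht.2]
      induction k with
      | zero => simp only [mulG, hc, if_false, bevG_single, bvalG]; field_simp; ring
      | succ k IH =>
        simp only [mulG, hc, if_false, bevG_sub, bevG_smul, bevG_single]
        rw [← IH trivial]
        simp only [bvalG]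
        field_simp
        ring
  | GB.invPow k, _, c, t, ht => by
    have ht0 : t ≠ 0 := ht.1.ne'
    by_cases hc : σ c = 0
    · rw [pden_of_eq_zero hc ht.1]
      cases k with
      | zero => simp only [mulG, hc, if_true, bevG_single, bvalG]; field_simp; ring
      | succ k => simp only [mulG, hc, if_true, bevG_single, bvalG]; field_simp; ring
    · have hct : σ c - t ≠ 0 := sub_ne_zero_of_adm hσ c ht
      rw [pden_of_ne_zero hσ hc ht.2]
      induction k with
      | zero =>
        simp only [mulG, hc, if_false, bevG_smul, bevG_add, bevG_single, bvalG]
        field_simp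
        ring
      | succ k IH =>
        simp only [mulG, hc, if_false, bevG_smul, bevG_add, bevG_single]
        rw [← IH trivial]
        simp only [bvalG]
        field_simp
        ring
  | GB.invLet a k, ha, c, t, ht => by
    have ht0 : t ≠ 0 := ht.1.ne'
    have ha0 : σ a ≠ 0 := ha
    have hat : σ a - t ≠ 0 := sub_ne_zero_of_adm hσ a ht
    by_cases hc : σ c = 0
    · rw [pden_of_eq_zero hc ht.1]
      induction k with
      | zero =>
        simp only [mulG, hc, if_true, bevG_smul, bevG_add, bevG_single, bvalG]
        field_simp
        ring
      | succ k IH =>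
        simp only [mulG, hc, if_true, bevG_smul, bevG_add, bevG_single]
        rw [← IH ha]
        simp only [bvalG]
        field_simp
        ring
    · have hct : σ c - t ≠ 0 := sub_ne_zero_of_adm hσ c ht
      rw [pden_of_ne_zero hσ hc ht.2]
      by_cases hca : σ c = σ a
      · cases k with
        | zero => simp only [mulG, hca, if_false, if_true, bevG_single, bvalG, ha0]; rw [← hca]; field_simp; ring
        | succ k => simp only [mulG, hca, if_false, if_true, bevG_single, bvalG, ha0]; rw [← hca]; field_simp; ring
      · have hd : σ c - σ a ≠ 0 := sub_ne_zero.2 hca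
        induction k with
        | zero =>
          simp only [mulG, hc, hca, if_false, bevG_smul, bevG_sub, bevG_single, bvalG]
          field_simp
          ring
        | succ k IH =>
          simp only [mulG, hc, hca, if_false, bevG_smul, bevG_sub, bevG_single]
          rw [← IH ha]
          simp only [bvalG]
          field_simp
          ring

omit hσ in
/-- The table only produces admissible basis elements. [folklore] -/
theorem mulG_ok {K : Type*} [CommRing K] [Inv K] {σ : α → K} :
    ∀ (β : GB α), GB.ok σ β → ∀ (c : α), ∀ γ ∈ (mulG σ β c).support, GB.ok σ γ := by
  classical
  have hs : ∀ (γ δ : GB α) (r : K), γ ∈ (Finsupp.single δ r).support → γ = δ := fun γ δ r h =>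
    Finset.mem_singleton.1 (Finsupp.support_single_subset h)
  have hadd : ∀ (f g : GB α →₀ K) (γ : GB α), γ ∈ (f + g).support → γ ∈ f.support ∨ γ ∈ g.support :=
    fun f g γ h => by
      have := Finsupp.support_add h
      simpa [Finset.mem_union] using this
  have hsub : ∀ (f g : GB α →₀ K) (γ : GB α), γ ∈ (f - g).support → γ ∈ f.support ∨ γ ∈ g.support :=
    fun f g γ h => by
      rw [sub_eq_add_neg] at h
      rcases hadd f (-g) γ h with h | h
      · exact Or.inl h
      · exact Or.inr (by simpa using h)
  have hsmul : ∀ (r : K) (f : GB α →₀ K) (γ : GB α), γ ∈ (r • f).support → γ ∈ f.support :=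
    fun r f γ h => Finsupp.support_smul h
  intro β hβ c
  induction β with
  | pow k =>
    induction k with
    | zero =>
      intro γ hγ; simp only [mulG] at hγ
      split_ifs at hγ with hc
      · rw [hs _ _ _ hγ]; trivial
      · rw [hs _ _ _ hγ]; exact hc
    | succ k IH =>
      intro γ hγ; simp only [mulG] at hγ
      split_ifs at hγ with hc
      · rw [hs _ _ _ hγ]; trivial
      · rcases hsub _ _ _ hγ with h | h
        · exact IH trivial γ (hsmul _ _ _ h)
        · rw [hs _ _ _ h]; trivial
  | invPow k =>
    induction k with
    | zero =>
      intro γ hγ; simp only [mulG] at hγ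
      split_ifs at hγ with hc
      · rw [hs _ _ _ hγ]; trivial
      · rcases hadd _ _ _ (hsmul _ _ _ hγ) with h | h
        · rw [hs _ _ _ h]; trivial
        · rw [hs _ _ _ h]; exact hc
    | succ k IH =>
      intro γ hγ; simp only [mulG] at hγ
      split_ifs at hγ with hc
      · rw [hs _ _ _ hγ]; trivial
      · rcases hadd _ _ _ (hsmul _ _ _ hγ) with h | h
        · rw [hs _ _ _ h]; trivial
        · exact IH trivial γ h
  | invLet a k =>
    have ha : σ a ≠ 0 := hβ
    induction k with
    | zero =>
      intro γ hγ; simp only [mulG] at hγ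
      split_ifs at hγ with hc hca
      · rcases hadd _ _ _ (hsmul _ _ _ hγ) with h | h
        · rw [hs _ _ _ h]; trivial
        · rw [hs _ _ _ h]; exact ha
      · rw [hs _ _ _ hγ]; exact ha
      · rcases hsub _ _ _ (hsmul _ _ _ hγ) with h | h
        · rw [hs _ _ _ h]; exact ha
        · rw [hs _ _ _ h]; exact hc
    | succ k IH =>
      intro γ hγ; simp only [mulG] at hγ
      split_ifs at hγ with hc hca
      · rcases hadd _ _ _ (hsmul _ _ _ hγ) with h | h
        · exact IH ha γ h
        · rw [hs _ _ _ h]; exact ha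
      · rw [hs _ _ _ hγ]; exact ha
      · rcases hsub _ _ _ (hsmul _ _ _ hγ) with h | h
        · rw [hs _ _ _ h]; exact ha
        · exact IH ha γ h

end GBasis

/-! ### The class `ℝ[t, t⁻¹, (σ_a - t)⁻¹] ⊗ ℝ⟨words⟩` and primitives inside it -/

section GClass

variable [DecidableEq α] (σ : α → ℝ) (z : α)

/-- Index of the class: a basis function and a word. [folklore] -/
abbrev GH (α : Type*) := GB α × List α

/-- Evaluation `ev(F)(t) = Σ F_{β,W} b_β(t) L(t)_W` with `L = hlogSeries σ z` the regularised
hyperlogarithms. [folklore] -/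
def hevG (F : GH α →₀ ℝ) (t : ℝ) : ℝ :=
  F.sum fun x r => r * (bvalG σ x.1 t * hlogSeries σ z t x.2)

/-- `hevG` of a single. [folklore] -/
@[simp] theorem hevG_single (x : GH α) (r t : ℝ) :
    hevG σ z (Finsupp.single x r) t = r * (bvalG σ x.1 t * hlogSeries σ z t x.2) := by
  unfold hevG; rw [Finsupp.sum_single_index]; simp

/-- `hevG` is additive. [folklore] -/
theorem hevG_add (F G : GH α →₀ ℝ) (t : ℝ) : hevG σ z (F + G) t = hevG σ z F t + hevG σ z G t := by
  unfold hevG; rw [Finsupp.sum_add_index'] <;> intros <;> simp [add_mul]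

/-- `hevG 0 = 0`. [folklore] -/
@[simp] theorem hevG_zero (t : ℝ) : hevG σ z 0 t = 0 := by simp [hevG]

/-- `hevG` commutes with scalars. [folklore] -/
theorem hevG_smul (r : ℝ) (F : GH α →₀ ℝ) (t : ℝ) : hevG σ z (r • F) t = r * hevG σ z F t := by
  unfold hevG
  rw [Finsupp.sum_smul_index' (fun _ => by simp)]
  simp only [Finsupp.sum, Finset.mul_sum, smul_eq_mul, mul_assoc]

/-- `hevG` as an additive monoid homomorphism (pointwise at `t`). [folklore] -/
def hevGHom (t : ℝ) : (GH α →₀ ℝ) →+ ℝ where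
  toFun F := hevG σ z F t
  map_zero' := hevG_zero σ z t
  map_add' F G := hevG_add σ z F G t

/-- `hevG` of a `Finsupp.sum`. [folklore] -/
theorem hevG_finsupp_sum {ι N : Type*} [Zero N] (f : ι →₀ N) (g : ι → N → GH α →₀ ℝ) (t : ℝ) :
    hevG σ z (f.sum g) t = f.sum fun i m => hevG σ z (g i m) t :=
  map_finsuppSum (hevGHom σ z t) f g

/-- `hevG` of a finite sum. [folklore] -/
theorem hevG_finset_sum {ι : Type*} (s : Finset ι) (g : ι → GH α →₀ ℝ) (t : ℝ) :
    hevG σ z (∑ i ∈ s, g i) t = ∑ i ∈ s, hevG σ z (g i) t :=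
  map_sum (hevGHom σ z t) g s

/-- `hevG` of a difference. [folklore] -/
theorem hevG_sub (F G : GH α →₀ ℝ) (t : ℝ) : hevG σ z (F - G) t = hevG σ z F t - hevG σ z G t :=
  map_sub (hevGHom σ z t) F G

/-- **Primitive of `b_β L_W` inside the class**, by integration by parts and recursion on the word:
`∫ L_W/t = L_{zW}`, `∫ L_W/(σ_a-t) = L_{aW}`, `∫ t^k L_{cW} = t^{k+1}L_{cW}/(k+1) - (k+1)⁻¹ ∫ (t^{k+1}ρ_c) L_W`
etc.; over any commutative ring of coefficients with an inverse. [folklore] -/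
def primBG {K : Type*} [CommRing K] [Inv K] (σ : α → K) (z : α) : GB α → List α → (GH α →₀ K)
  | GB.pow k, [] => Finsupp.single (GB.pow (k + 1), []) ((k + 1 : K)⁻¹)
  | GB.invPow 0, W => Finsupp.single (GB.pow 0, z :: W) 1
  | GB.invPow (k + 1), [] => Finsupp.single (GB.invPow k, []) (-(k + 1 : K)⁻¹)
  | GB.invLet a 0, W => Finsupp.single (GB.pow 0, a :: W) 1
  | GB.invLet a (k + 1), [] => Finsupp.single (GB.invLet a k, []) ((k + 1 : K)⁻¹)
  | GB.pow k, c :: W => Finsupp.single (GB.pow (k + 1), c :: W) ((k + 1 : K)⁻¹)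
      - (k + 1 : K)⁻¹ • (mulG σ (GB.pow (k + 1)) c).sum (fun γ m => m • primBG σ z γ W)
  | GB.invPow (k + 1), c :: W => Finsupp.single (GB.invPow k, c :: W) (-(k + 1 : K)⁻¹)
      + (k + 1 : K)⁻¹ • (mulG σ (GB.invPow k) c).sum (fun γ m => m • primBG σ z γ W)
  | GB.invLet a (k + 1), c :: W => Finsupp.single (GB.invLet a k, c :: W) ((k + 1 : K)⁻¹)
      - (k + 1 : K)⁻¹ • (mulG σ (GB.invLet a k) c).sum (fun γ m => m • primBG σ z γ W)

/-- Admissible elements of the class: all basis functions occurring are admissible. [folklore] -/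
def GH.ok {K : Type*} [CommRing K] (σ : α → K) (F : GH α →₀ K) : Prop := ∀ x ∈ F.support, GB.ok σ x.1

/-- **The primitive of an element of the class**, by linearity. [folklore] -/
def primG {K : Type*} [CommRing K] [Inv K] (σ : α → K) (z : α) (F : GH α →₀ K) : GH α →₀ K :=
  F.sum fun x r => r • primBG σ z x.1 x.2

variable {σ z} (hz : σ z = 0) (hσz : ∀ c, c ≠ z → 1 ≤ σ c)
include hz hσz

omit [DecidableEq α] in
/-- The derived admissibility. [folklore] -/
theorem adm_of_hz : ∀ c, σ c = 0 ∨ 1 ≤ σ c := adm_of_zero_letter σ hz hσz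

omit hz hσz in
/-- Derivative of `hevG` of a recursive sum `Σ_γ m_γ primBG γ W` from the derivatives of the pieces.
[folklore] -/
theorem hasDerivAt_hevG_sum (f : GB α →₀ ℝ) (W : List α) {t : ℝ}
    (IH : ∀ γ ∈ f.support, HasDerivAt (hevG σ z (primBG σ z γ W)) (bvalG σ γ t * hlogSeries σ z t W) t) :
    HasDerivAt (hevG σ z (f.sum fun γ m => m • primBG σ z γ W))
      (bevG σ f t * hlogSeries σ z t W) t := by
  have hfun : hevG σ z (f.sum fun γ m => m • primBG σ z γ W) =
      fun t => ∑ γ ∈ f.support, f γ * hevG σ z (primBG σ z γ W) t := by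
    funext t'
    rw [hevG_finsupp_sum]
    simp only [Finsupp.sum, hevG_smul]
  rw [hfun]
  have h := HasDerivAt.sum (u := f.support) (A := fun γ t => f γ * hevG σ z (primBG σ z γ W) t)
    (A' := fun γ => f γ * (bvalG σ γ t * hlogSeries σ z t W)) (x := t)
    fun γ hγ => (IH γ hγ).const_mul _
  have hfun2 : (fun t => ∑ γ ∈ f.support, f γ * hevG σ z (primBG σ z γ W) t) =
      ∑ γ ∈ f.support, fun t => f γ * hevG σ z (primBG σ z γ W) t := by
    funext t'; rw [Finset.sum_apply]
  rw [hfun2]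
  refine h.congr_deriv ?_
  unfold bevG
  simp only [Finsupp.sum, Finset.sum_mul, mul_assoc]

/-- **Derivative of a basic product** `b_β(t) L(t)_{cW}`. [folklore] -/
theorem hasDerivAt_bvalG_mul_hlogSeries_cons {β : GB α} (hβ : GB.ok σ β) (c : α) (W : List α) {t : ℝ}
    (ht : t ∈ Ioo (0 : ℝ) 1) :
    HasDerivAt (fun t => bvalG σ β t * hlogSeries σ z t (c :: W))
      (bevG σ (dG β) t * hlogSeries σ z t (c :: W) + bevG σ (mulG σ β c) t * hlogSeries σ z t W) t := by
  have h := (hasDerivAt_bvalG (adm_of_hz hz hσz) β ht).mul (hasDerivAt_hlogSeries_cons hz hσz c W ht)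
  refine h.congr_deriv ?_
  rw [← bvalG_mul_pden (adm_of_hz hz hσz) β hβ c ht]; ring

/-- Derivative of `b_β(t) L(t)_∅ = b_β(t)` on `(0,1)`. [folklore] -/
theorem hasDerivAt_bvalG_mul_hlogSeries_nil (β : GB α) {t : ℝ} (ht : t ∈ Ioo (0 : ℝ) 1) :
    HasDerivAt (fun t => bvalG σ β t * hlogSeries σ z t [])
      (bevG σ (dG β) t * hlogSeries σ z t []) t := by
  have hL : ∀ᶠ t' in 𝓝 t, hlogSeries σ z t' [] = 1 := by
    filter_upwards [KZ3.isOpen_Ioo01.mem_nhds ht] with t' ht'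
    exact hlogSeries_nil hz hσz ht'
  rw [hlogSeries_nil hz hσz ht, mul_one]
  refine (hasDerivAt_bvalG (adm_of_hz hz hσz) β ht).congr_of_eventuallyEq ?_
  filter_upwards [hL] with t' ht'
  rw [ht', mul_one]

/-- **The primitive is correct**: `∂_t hevG(primBG β W) = b_β(t) L(t)_W` on `(0,1)`, for admissible
`β`. [folklore] -/
theorem hasDerivAt_hevG_primBG : ∀ (W : List α) (β : GB α), GB.ok σ β → ∀ {t : ℝ}, t ∈ Ioo (0 : ℝ) 1 →
    HasDerivAt (hevG σ z (primBG σ z β W)) (bvalG σ β t * hlogSeries σ z t W) t := by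
  have hadm := adm_of_hz hz hσz
  intro W
  induction W with
  | nil =>
    intro β hβ t ht
    have ht0 : t ≠ 0 := ht.1.ne'
    have hL1 := hlogSeries_nil hz hσz ht
    cases β with
    | pow k =>
      show HasDerivAt (hevG σ z (Finsupp.single (GB.pow (k + 1), []) ((k + 1 : ℝ)⁻¹))) _ t
      have hf : hevG σ z (Finsupp.single (GB.pow (k + 1), ([] : List α)) ((k + 1 : ℝ)⁻¹)) =
          fun t => ((k + 1 : ℝ)⁻¹) * (bvalG σ (GB.pow (k + 1)) t * hlogSeries σ z t []) := by
        funext t'; rw [hevG_single]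
      rw [hf]
      refine ((hasDerivAt_bvalG_mul_hlogSeries_nil hz hσz (GB.pow (k + 1)) ht).const_mul _).congr_deriv ?_
      show ((k + 1 : ℝ)⁻¹) * (bevG σ (Finsupp.single (GB.pow k) (k + 1)) t * hlogSeries σ z t []) =
        bvalG σ (GB.pow k) t * hlogSeries σ z t []
      rw [bevG_single, hL1]; field_simp
    | invPow k =>
      cases k with
      | zero =>
        show HasDerivAt (hevG σ z (Finsupp.single (GB.pow 0, [z]) 1)) _ t
        have hf : hevG σ z (Finsupp.single (GB.pow 0, [z]) (1 : ℝ)) =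
            fun t => (1 : ℝ) * (bvalG σ (GB.pow 0) t * hlogSeries σ z t [z]) := by
          funext t'; rw [hevG_single]
        rw [hf]
        refine ((hasDerivAt_bvalG_mul_hlogSeries_cons hz hσz (β := GB.pow 0) trivial z [] ht).const_mul _).congr_deriv ?_
        rw [show dG (GB.pow 0) = (0 : GB α →₀ ℝ) from rfl, show mulG σ (GB.pow 0) z = Finsupp.single (GB.invPow 0) 1 by
          simp [mulG, hz], bevG_single, bevG_zero]
        simp [bvalG]
      | succ k =>
        show HasDerivAt (hevG σ z (Finsupp.single (GB.invPow k, []) (-((k + 1 : ℝ)⁻¹)))) _ t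
        have hf : hevG σ z (Finsupp.single (GB.invPow k, ([] : List α)) (-((k + 1 : ℝ)⁻¹))) =
            fun t => (-((k + 1 : ℝ)⁻¹)) * (bvalG σ (GB.invPow k) t * hlogSeries σ z t []) := by
          funext t'; rw [hevG_single]
        rw [hf]
        refine ((hasDerivAt_bvalG_mul_hlogSeries_nil hz hσz (GB.invPow k) ht).const_mul _).congr_deriv ?_
        show (-((k + 1 : ℝ)⁻¹)) * (bevG σ (Finsupp.single (GB.invPow (k + 1)) (-(k + 1 : ℝ))) t * hlogSeries σ z t []) =
          bvalG σ (GB.invPow (k + 1)) t * hlogSeries σ z t []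
        rw [bevG_single, hL1]; field_simp
    | invLet a k =>
      have ha : σ a ≠ 0 := hβ
      cases k with
      | zero =>
        show HasDerivAt (hevG σ z (Finsupp.single (GB.pow 0, [a]) 1)) _ t
        have hf : hevG σ z (Finsupp.single (GB.pow 0, [a]) (1 : ℝ)) =
            fun t => (1 : ℝ) * (bvalG σ (GB.pow 0) t * hlogSeries σ z t [a]) := by
          funext t'; rw [hevG_single]
        rw [hf]
        refine ((hasDerivAt_bvalG_mul_hlogSeries_cons hz hσz (β := GB.pow 0) trivial a [] ht).const_mul _).congr_deriv ?_
        rw [show dG (GB.pow 0) = (0 : GB α →₀ ℝ) from rfl, show mulG σ (GB.pow 0) a = Finsupp.single (GB.invLet a 0) 1 by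
          simp [mulG, ha], bevG_single, bevG_zero]
        simp [bvalG]
      | succ k =>
        show HasDerivAt (hevG σ z (Finsupp.single (GB.invLet a k, []) ((k + 1 : ℝ)⁻¹))) _ t
        have hf : hevG σ z (Finsupp.single (GB.invLet a k, ([] : List α)) ((k + 1 : ℝ)⁻¹)) =
            fun t => ((k + 1 : ℝ)⁻¹) * (bvalG σ (GB.invLet a k) t * hlogSeries σ z t []) := by
          funext t'; rw [hevG_single]
        rw [hf]
        refine ((hasDerivAt_bvalG_mul_hlogSeries_nil hz hσz (GB.invLet a k) ht).const_mul _).congr_deriv ?_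
        show ((k + 1 : ℝ)⁻¹) * (bevG σ (Finsupp.single (GB.invLet a (k + 1)) (k + 1)) t * hlogSeries σ z t []) =
          bvalG σ (GB.invLet a (k + 1)) t * hlogSeries σ z t []
        rw [bevG_single, hL1]; field_simp
  | cons c W IHW =>
    intro β hβ t ht
    have ht0 : t ≠ 0 := ht.1.ne'
    -- generic integration by parts step
    have hstep : ∀ (β₀ β₁ : GB α), GB.ok σ β₀ → ∀ (q : ℝ),
        q * bevG σ (dG β₀) t = bvalG σ β₁ t →
        HasDerivAt (hevG σ z (Finsupp.single (β₀, c :: W) q - q • (mulG σ β₀ c).sum (fun γ m => m • primBG σ z γ W)))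
          (bvalG σ β₁ t * hlogSeries σ z t (c :: W)) t := by
      intro β₀ β₁ hβ₀ q h1
      have IH : ∀ γ ∈ (mulG σ β₀ c).support, HasDerivAt (hevG σ z (primBG σ z γ W)) (bvalG σ γ t * hlogSeries σ z t W) t :=
        fun γ hγ => IHW γ (mulG_ok β₀ hβ₀ c γ hγ) ht
      have hf : hevG σ z (Finsupp.single (β₀, c :: W) q - q • (mulG σ β₀ c).sum (fun γ m => m • primBG σ z γ W)) =
          fun t => q * (bvalG σ β₀ t * hlogSeries σ z t (c :: W)) -
            q * hevG σ z ((mulG σ β₀ c).sum fun γ m => m • primBG σ z γ W) t := by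
        funext t'
        rw [hevG_sub, hevG_single, hevG_smul]
      rw [hf]
      refine (((hasDerivAt_bvalG_mul_hlogSeries_cons hz hσz hβ₀ c W ht).const_mul _).sub
        ((hasDerivAt_hevG_sum _ W IH).const_mul _)).congr_deriv ?_
      rw [mul_add, ← mul_assoc, h1]; ring
    have hstep' : ∀ (β₀ β₁ : GB α), GB.ok σ β₀ → ∀ (q : ℝ),
        q * bevG σ (dG β₀) t = bvalG σ β₁ t →
        HasDerivAt (hevG σ z (Finsupp.single (β₀, c :: W) q + (-q) • (mulG σ β₀ c).sum (fun γ m => m • primBG σ z γ W)))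
          (bvalG σ β₁ t * hlogSeries σ z t (c :: W)) t := by
      intro β₀ β₁ hβ₀ q h1
      have h := hstep β₀ β₁ hβ₀ q h1
      rwa [sub_eq_add_neg, ← neg_smul] at h
    cases β with
    | pow k =>
      show HasDerivAt (hevG σ z (Finsupp.single (GB.pow (k + 1), c :: W) ((k + 1 : ℝ)⁻¹)
        - ((k + 1 : ℝ)⁻¹) • (mulG σ (GB.pow (k + 1)) c).sum (fun γ m => m • primBG σ z γ W))) _ t
      refine hstep (GB.pow (k + 1)) (GB.pow k) trivial ((k + 1 : ℝ)⁻¹) ?_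
      show ((k + 1 : ℝ)⁻¹) * bevG σ (Finsupp.single (GB.pow k) (k + 1)) t = bvalG σ (GB.pow k) t
      rw [bevG_single]; field_simp
    | invPow k =>
      cases k with
      | zero =>
        show HasDerivAt (hevG σ z (Finsupp.single (GB.pow 0, z :: c :: W) 1)) _ t
        have hf : hevG σ z (Finsupp.single (GB.pow 0, z :: c :: W) (1 : ℝ)) =
            fun t => (1 : ℝ) * (bvalG σ (GB.pow 0) t * hlogSeries σ z t (z :: c :: W)) := by
          funext t'; rw [hevG_single]
        rw [hf]
        refine ((hasDerivAt_bvalG_mul_hlogSeries_cons hz hσz (β := GB.pow 0) trivial z (c :: W) ht).const_mul _).congr_deriv ?_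
        rw [show dG (GB.pow 0) = (0 : GB α →₀ ℝ) from rfl, show mulG σ (GB.pow 0) z = Finsupp.single (GB.invPow 0) 1 by
          simp [mulG, hz], bevG_single, bevG_zero]
        simp [bvalG]
      | succ k =>
        show HasDerivAt (hevG σ z (Finsupp.single (GB.invPow k, c :: W) (-((k + 1 : ℝ)⁻¹))
          + ((k + 1 : ℝ)⁻¹) • (mulG σ (GB.invPow k) c).sum (fun γ m => m • primBG σ z γ W))) _ t
        have h := hstep' (GB.invPow k) (GB.invPow (k + 1)) trivial (-((k + 1 : ℝ)⁻¹)) ?_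
        · simpa only [neg_neg] using h
        · show (-((k + 1 : ℝ)⁻¹)) * bevG σ (Finsupp.single (GB.invPow (k + 1)) (-(k + 1 : ℝ))) t = bvalG σ (GB.invPow (k + 1)) t
          rw [bevG_single]; field_simp
    | invLet a k =>
      have ha : σ a ≠ 0 := hβ
      cases k with
      | zero =>
        show HasDerivAt (hevG σ z (Finsupp.single (GB.pow 0, a :: c :: W) 1)) _ t
        have hf : hevG σ z (Finsupp.single (GB.pow 0, a :: c :: W) (1 : ℝ)) =
            fun t => (1 : ℝ) * (bvalG σ (GB.pow 0) t * hlogSeries σ z t (a :: c :: W)) := by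
          funext t'; rw [hevG_single]
        rw [hf]
        refine ((hasDerivAt_bvalG_mul_hlogSeries_cons hz hσz (β := GB.pow 0) trivial a (c :: W) ht).const_mul _).congr_deriv ?_
        rw [show dG (GB.pow 0) = (0 : GB α →₀ ℝ) from rfl, show mulG σ (GB.pow 0) a = Finsupp.single (GB.invLet a 0) 1 by
          simp [mulG, ha], bevG_single, bevG_zero]
        simp [bvalG]
      | succ k =>
        show HasDerivAt (hevG σ z (Finsupp.single (GB.invLet a k, c :: W) ((k + 1 : ℝ)⁻¹)
          - ((k + 1 : ℝ)⁻¹) • (mulG σ (GB.invLet a k) c).sum (fun γ m => m • primBG σ z γ W))) _ t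
        refine hstep (GB.invLet a k) (GB.invLet a (k + 1)) ha ((k + 1 : ℝ)⁻¹) ?_
        show ((k + 1 : ℝ)⁻¹) * bevG σ (Finsupp.single (GB.invLet a (k + 1)) (k + 1)) t = bvalG σ (GB.invLet a (k + 1)) t
        rw [bevG_single]; field_simp

/-- **`∂_t hevG(primG F) = hevG F` on `(0,1)`** for admissible `F`. [folklore] -/
theorem hasDerivAt_hevG_primG {F : GH α →₀ ℝ} (hF : GH.ok σ F) {t : ℝ} (ht : t ∈ Ioo (0 : ℝ) 1) :
    HasDerivAt (hevG σ z (primG σ z F)) (hevG σ z F t) t := by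
  have hfun : hevG σ z (primG σ z F) = fun t => ∑ x ∈ F.support, F x * hevG σ z (primBG σ z x.1 x.2) t := by
    funext t'
    rw [primG, hevG_finsupp_sum]
    simp only [Finsupp.sum, hevG_smul]
  rw [hfun]
  have h := HasDerivAt.sum (u := F.support) (A := fun x t => F x * hevG σ z (primBG σ z x.1 x.2) t)
    (A' := fun x => F x * (bvalG σ x.1 t * hlogSeries σ z t x.2)) (x := t)
    fun x hx => (hasDerivAt_hevG_primBG hz hσz x.2 x.1 (hF x hx) ht).const_mul _
  have hfun2 : (fun t => ∑ x ∈ F.support, F x * hevG σ z (primBG σ z x.1 x.2) t) =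
      ∑ x ∈ F.support, fun t => F x * hevG σ z (primBG σ z x.1 x.2) t := by
    funext t'; rw [Finset.sum_apply]
  rw [hfun2]
  refine h.congr_deriv ?_
  unfold hevG
  simp only [Finsupp.sum]

end GClass

/-! ### Taylor data of the basis functions at both end-points -/

section TaylorData

open Finset

/-- Coefficients of the `n`-th power of a Taylor series with coefficients `ψ`. [folklore] -/
def powTaylor (ψ : ℕ → ℝ) : ℕ → ℕ → ℝ
  | 0, i => if i = 0 then 1 else 0
  | n + 1, i => ∑ jk ∈ antidiagonal i, powTaylor ψ n jk.1 * ψ jk.2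

/-- Powers of a function with a Taylor expansion. [folklore] -/
theorem HasTaylor.pow' {ρ : ℝ → ℝ} {ψ : ℕ → ℝ} (h : HasTaylor ρ ψ) :
    ∀ n : ℕ, HasTaylor (fun a => ρ a ^ n) (powTaylor ψ n)
  | 0 => by
    have : HasTaylor (fun _ : ℝ => (1 : ℝ)) (fun i => if i = 0 then 1 else 0) :=
      hasTaylor_of_finite 0 (fun i hi => if_neg (by omega)) (Eventually.of_forall fun a => by simp)
    simpa [powTaylor] using this
  | n + 1 => by
    have h1 := (HasTaylor.pow' h n).mul h
    refine (show HasTaylor (fun a => ρ a ^ (n + 1)) _ from ?_)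
    have hf : (fun a => ρ a ^ (n + 1)) = fun a => ρ a ^ n * ρ a := by funext a; rw [pow_succ]
    rw [hf]
    exact h1

/-- The constant coefficient of a power. [folklore] -/
theorem powTaylor_zero (ψ : ℕ → ℝ) : ∀ n : ℕ, powTaylor ψ n 0 = ψ 0 ^ n
  | 0 => by simp [powTaylor]
  | n + 1 => by
    rw [powTaylor, Finset.Nat.antidiagonal_zero, Finset.sum_singleton, powTaylor_zero ψ n, pow_succ]

/-- Taylor expansion of `1/(A - t)` at `t = 0⁺` for `A ≥ 1`. [folklore] -/
theorem hasTaylor_inv_sub {A : ℝ} (hA : 1 ≤ A) :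
    HasTaylor (fun t : ℝ => (A - t)⁻¹) (fun i => 1 / A ^ (i + 1)) := by
  intro M
  have hA0 : 0 < A := by linarith
  refine ⟨2 / A ^ (M + 2), ?_⟩
  filter_upwards [Ioo_mem_nhdsGT (by norm_num : (0 : ℝ) < 1 / 2)] with t ht
  have hAt : 0 < A - t := by linarith [ht.2]
  have hq : t / A ≠ 1 := by
    have : t / A < 1 := by rw [div_lt_one hA0]; linarith [ht.2]
    exact this.ne
  -- the geometric sum
  have htA : t - A ≠ 0 := by linarith
  have ht0 : 0 < t := ht.1
  have hgeom : ∑ i ∈ range (M + 1), 1 / A ^ (i + 1) * t ^ i = (1 - (t / A) ^ (M + 1)) / (A - t) := by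
    have h := geom_sum_eq hq (M + 1)
    have h2 : ∑ i ∈ range (M + 1), 1 / A ^ (i + 1) * t ^ i = (1 / A) * ∑ i ∈ range (M + 1), (t / A) ^ i := by
      rw [Finset.mul_sum]
      refine Finset.sum_congr rfl fun i _ => ?_
      rw [div_pow, pow_succ]; field_simp
    have hqA : t / A - 1 = (t - A) / A := by field_simp
    rw [h2, h, hqA, div_div_eq_mul_div]
    have hAt' : A - t = -(t - A) := by ring
    rw [hAt', div_neg, eq_neg_iff_add_eq_zero]
    have : 1 / A * (((t / A) ^ (M + 1) - 1) * A / (t - A)) = ((t / A) ^ (M + 1) - 1) / (t - A) := by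
      field_simp
    rw [this, ← add_div, div_eq_zero_iff]
    left; ring
  rw [hgeom]
  have hdiff : (A - t)⁻¹ - (1 - (t / A) ^ (M + 1)) / (A - t) = (t / A) ^ (M + 1) / (A - t) := by
    field_simp; ring
  rw [hdiff, abs_div, abs_of_pos hAt, abs_pow, abs_of_nonneg (div_nonneg ht.1.le hA0.le), div_pow]
  have h2At : A ≤ 2 * (A - t) := by linarith [ht.2]
  calc t ^ (M + 1) / A ^ (M + 1) / (A - t) ≤ t ^ (M + 1) / A ^ (M + 1) / (A / 2) :=
        div_le_div_of_nonneg_left (by positivity) (by linarith) (by linarith)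
    _ = 2 / A ^ (M + 2) * t ^ (M + 1) := by rw [pow_succ A (M + 1)]; field_simp

/-- Taylor coefficients of `1 - s`. [folklore] -/
def oneSubTaylor (i : ℕ) : ℝ := if i = 0 then 1 else if i = 1 then -1 else 0

/-- `1 - s` has the Taylor coefficients `oneSubTaylor`. [folklore] -/
theorem hasTaylor_one_sub : HasTaylor (fun s : ℝ => 1 - s) oneSubTaylor := by
  refine hasTaylor_of_finite 1 (fun i hi => ?_) (Eventually.of_forall fun a => ?_)
  · simp only [oneSubTaylor]; rw [if_neg (by omega), if_neg (by omega)]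
  · simp [oneSubTaylor, Finset.sum_range_succ]; ring

variable [DecidableEq α] {σ : α → ℝ} {z : α} (hz : σ z = 0) (hσz : ∀ c, c ≠ z → 1 ≤ σ c)

/-- The Taylor coefficients at `t = 0⁺` of the basis function written as `t^{j} ρ(t)`:
the exponent `j`. [folklore] -/
def zexp0 : GB α → ℤ
  | GB.pow k => k
  | GB.invPow k => -(k + 1 : ℤ)
  | GB.invLet _ _ => 0

/-- The Taylor coefficients at `t = 0⁺` of the regular factor `ρ`. [folklore] -/
def tay0 (σ : α → ℝ) : GB α → ℕ → ℝ
  | GB.pow _ => fun i => if i = 0 then 1 else 0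
  | GB.invPow _ => fun i => if i = 0 then 1 else 0
  | GB.invLet a k => powTaylor (fun i => 1 / σ a ^ (i + 1)) (k + 1)

include hz hσz in
omit [DecidableEq α] in
/-- The factorisation at `0⁺`: `b_β(t) = t^{j} ρ(t)` with `ρ` of Taylor coefficients `tay0`, for
admissible `β`. [folklore] -/
theorem hasTaylor_tay0 {β : GB α} (hβ : GB.ok σ β) : ∃ ρ : ℝ → ℝ, HasTaylor ρ (tay0 σ β) ∧
    ∀ t ∈ Ioo (0 : ℝ) 1, bvalG σ β t = t ^ zexp0 β * ρ t := by
  have hone : HasTaylor (fun _ : ℝ => (1 : ℝ)) (fun i => if i = 0 then 1 else 0) :=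
    hasTaylor_of_finite 0 (fun i hi => if_neg (by omega)) (Eventually.of_forall fun a => by simp)
  cases β with
  | pow k => exact ⟨fun _ => 1, hone, fun t _ => by simp [bvalG, zexp0]⟩
  | invPow k =>
    refine ⟨fun _ => 1, hone, fun t ht => ?_⟩
    simp only [bvalG, zexp0, mul_one]
    rw [zpow_neg]
    norm_cast
  | invLet a k =>
    have ha : σ a ≠ 0 := hβ
    have ha1 : 1 ≤ σ a := by
      rcases adm_of_zero_letter σ hz hσz a with h | h
      · exact absurd h ha
      · exact h
    refine ⟨fun t => ((σ a - t)⁻¹) ^ (k + 1), (hasTaylor_inv_sub ha1).pow' (k + 1), fun t _ => ?_⟩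
    simp only [bvalG, zexp0, zpow_zero, one_mul, inv_pow]

/-- The exponent `j` at `1⁻`: `b_β(1-s) = s^{j} ρ(s)`. [folklore] -/
def zexp1 (σ : α → ℝ) : GB α → ℤ
  | GB.pow _ => 0
  | GB.invPow _ => 0
  | GB.invLet a k => if σ a = 1 then -(k + 1 : ℤ) else 0

/-- The Taylor coefficients at `1⁻` of the regular factor. [folklore] -/
def tay1 (σ : α → ℝ) : GB α → ℕ → ℝ
  | GB.pow k => powTaylor oneSubTaylor k
  | GB.invPow k => powTaylor (fun _ => 1) (k + 1)
  | GB.invLet a k => if σ a = 1 then (fun i => if i = 0 then 1 else 0)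
      else powTaylor (fun i => (-1) ^ i / (σ a - 1) ^ (i + 1)) (k + 1)

include hz hσz in
omit [DecidableEq α] in
/-- The factorisation at `1⁻`: `b_β(1-s) = s^{j} ρ(s)` with `ρ` of Taylor coefficients `tay1`, for
admissible `β`. [folklore] -/
theorem hasTaylor_tay1 {β : GB α} (hβ : GB.ok σ β) : ∃ ρ : ℝ → ℝ, HasTaylor ρ (tay1 σ β) ∧
    ∀ s ∈ Ioo (0 : ℝ) 1, bvalG σ β (1 - s) = s ^ zexp1 σ β * ρ s := by
  have hone : HasTaylor (fun _ : ℝ => (1 : ℝ)) (fun i => if i = 0 then 1 else 0) :=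
    hasTaylor_of_finite 0 (fun i hi => if_neg (by omega)) (Eventually.of_forall fun a => by simp)
  cases β with
  | pow k => exact ⟨fun s => (1 - s) ^ k, hasTaylor_one_sub.pow' k, fun s _ => by simp [bvalG, zexp1]⟩
  | invPow k =>
    refine ⟨fun s => ((1 - s)⁻¹) ^ (k + 1), hasTaylor_inv_one_sub.pow' (k + 1), fun s hs => ?_⟩
    simp only [bvalG, zexp1, zpow_zero, one_mul, inv_pow]
  | invLet a k =>
    have ha : σ a ≠ 0 := hβ
    by_cases ha1 : σ a = 1
    · refine ⟨fun _ => 1, by simpa [tay1, ha1] using hone, fun s hs => ?_⟩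
      simp only [bvalG, zexp1, ha1, if_true, mul_one, sub_sub_cancel]
      rw [zpow_neg]
      norm_cast
    · have hgt : 1 < σ a := by
        rcases adm_of_zero_letter σ hz hσz a with h | h
        · exact absurd h ha
        · exact lt_of_le_of_ne h (Ne.symm ha1)
      refine ⟨fun s => ((σ a - 1 + s)⁻¹) ^ (k + 1), by simpa [tay1, ha1] using (hasTaylor_inv_sub_add hgt).pow' (k + 1),
        fun s hs => ?_⟩
      simp only [bvalG, zexp1, ha1, if_false, zpow_zero, one_mul, inv_pow]
      congr 1
      ring

end TaylorData

/-! ### Regularised values of the class at `0⁺` and at `1⁻` -/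

section GRegValues

open Finset

variable [DecidableEq α] {σ : α → ℝ} {z : α} (hz : σ z = 0) (hσz : ∀ c, c ≠ z → 1 ≤ σ c)
include hz hσz

/-- The regularised value at `0⁺` of `b_β(t) L(t)_W`. [folklore] -/
def val0 (σ : α → ℝ) (z : α) (β : GB α) (W : List α) : ℝ :=
  if zexp0 β ≤ 0 then ∑ ik ∈ antidiagonal (-zexp0 β).toNat, tay0 σ β ik.1 * regCoeff σ z W ik.2 else 0

/-- `b_β(t) L(t)_W` has the regularised value `val0 β W` at `0⁺`. [folklore] -/
theorem hasRegValue_bvalG_mul_hlogSeries {β : GB α} (hβ : GB.ok σ β) (W : List α) :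
    HasRegValue (fun a => bvalG σ β a * hlogSeries σ z a W) (val0 σ z β W) := by
  obtain ⟨ρ, hρ, hfac⟩ := hasTaylor_tay0 hz hσz hβ
  have h := hasRegValue_zpow_mul_taylor_mul_hlogSeries hz hσz hρ (zexp0 β) W
  refine h.congr ?_
  filter_upwards [Ioo_mem_nhdsGT (zero_lt_one' ℝ)] with a ha
  rw [hfac a ha]

/-- The regularised value at `1⁻` of `b_β(1-s) L(1-s)_W`, through the expansion coefficients at the
top of layer IX. [folklore] -/
def val1 (β : GB α) (W : List α) : ℝ :=
  if zexp1 σ β ≤ 0 then ∑ ij ∈ antidiagonal (-zexp1 σ β).toNat, tay1 σ β ij.1 * topCoeff hz hσz W ij.2 0 else 0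

/-- `b_β(1-s) L(1-s)_W` has the regularised value `val1 β W` at `s = 0⁺`. [folklore] -/
theorem hasRegValue_bvalG_one_sub_mul_hlogSeries {β : GB α} (hβ : GB.ok σ β) (W : List α) :
    HasRegValue (fun s => bvalG σ β (1 - s) * hlogSeries σ z (1 - s) W) (val1 hz hσz β W) := by
  obtain ⟨ρ, hρ, hfac⟩ := hasTaylor_tay1 hz hσz hβ
  have hlt := hρ.mul_hasLogTaylor (hasLogTaylor_hlogSeries_one_sub hz hσz W)
  have h := hlt.hasRegValue_zpow_mul (zexp1 σ β)
  have hval : (if zexp1 σ β ≤ 0 then (fun m k => ∑ ij ∈ antidiagonal m, tay1 σ β ij.1 * topCoeff hz hσz W ij.2 k)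
      (-zexp1 σ β).toNat 0 else 0) = val1 hz hσz β W := by
    unfold val1; rfl
  rw [hval] at h
  refine h.congr ?_
  filter_upwards [Ioo_mem_nhdsGT (zero_lt_one' ℝ)] with s hs
  rw [hfac s hs, mul_assoc]

/-- **The regularised value at `0⁺` of an element of the class.** [folklore] -/
def reg0G (σ : α → ℝ) (z : α) (F : GH α →₀ ℝ) : ℝ := F.sum fun x r => r * val0 σ z x.1 x.2

/-- `hevG F` has the regularised value `reg0G F` at `0⁺`, for admissible `F`. [folklore] -/
theorem hasRegValue_hevG {F : GH α →₀ ℝ} (hF : GH.ok σ F) : HasRegValue (hevG σ z F) (reg0G σ z F) := by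
  have h := HasRegValue.sum F.support (φ := fun x a => F x * (bvalG σ x.1 a * hlogSeries σ z a x.2))
    (c := fun x => F x * val0 σ z x.1 x.2) fun x hx => (hasRegValue_bvalG_mul_hlogSeries hz hσz (hF x hx) x.2).smul _
  exact h

/-- **The regularised value at `1⁻`** of an element of the class. [folklore] -/
def reg1G (F : GH α →₀ ℝ) : ℝ := F.sum fun x r => r * val1 hz hσz x.1 x.2

/-- `s ↦ hevG F (1 - s)` has the regularised value `reg1G F` at `0⁺`, for admissible `F`. [folklore] -/
theorem hasRegValue_hevG_one_sub {F : GH α →₀ ℝ} (hF : GH.ok σ F) :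
    HasRegValue (fun s => hevG σ z F (1 - s)) (reg1G hz hσz F) := by
  have h := HasRegValue.sum F.support (φ := fun x s => F x * (bvalG σ x.1 (1 - s) * hlogSeries σ z (1 - s) x.2))
    (c := fun x => F x * val1 hz hσz x.1 x.2) fun x hx =>
      (hasRegValue_bvalG_one_sub_mul_hlogSeries hz hσz (hF x hx) x.2).smul _
  refine h.congr (Eventually.of_forall fun s => ?_)
  unfold hevG
  simp only [Finsupp.sum]

end GRegValues

/-! ### Theorem F₁ for general alphabets: evaluation of the integral -/

section GTheoremF1

variable [DecidableEq α] {σ : α → ℝ} {z : α} (hz : σ z = 0) (hσz : ∀ c, c ≠ z → 1 ≤ σ c)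
include hz hσz

omit [DecidableEq α] in
/-- The basis functions are continuous on `(0,1)`. [folklore] -/
theorem continuousOn_bvalG (β : GB α) : ContinuousOn (bvalG σ β) (Ioo 0 1) :=
  continuousOn_of_forall_continuousAt fun _ ht => (hasDerivAt_bvalG (adm_of_zero_letter σ hz hσz) β ht).continuousAt

/-- Elements of the class are continuous on `(0,1)`. [folklore] -/
theorem continuousOn_hevG (F : GH α →₀ ℝ) : ContinuousOn (hevG σ z F) (Ioo 0 1) := by
  have h : hevG σ z F = fun t => ∑ x ∈ F.support, F x * (bvalG σ x.1 t * hlogSeries σ z t x.2) := by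
    funext t; rfl
  rw [h]
  refine continuousOn_finsetSum _ fun x _ => continuousOn_const.mul ((continuousOn_bvalG hz hσz x.1).mul ?_)
  exact continuousOn_hlogSeries hz hσz x.2

omit hz hσz in
/-- Supports of the primitives consist of admissible basis elements. [folklore] -/
theorem primBG_ok {K : Type*} [CommRing K] [Inv K] {σ : α → K} {z : α} :
    ∀ (W : List α) (β : GB α), GB.ok σ β → GH.ok σ (primBG σ z β W) := by
  classical
  have hsingle : ∀ (y x : GH α) (q : K), x ∈ (Finsupp.single y q).support → x = y :=
    fun y x q hx => Finset.mem_singleton.1 (Finsupp.support_single_subset hx)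
  have hrec : ∀ (W : List α) (f : GB α →₀ K), (∀ γ ∈ f.support, GB.ok σ γ) →
      (∀ γ, GB.ok σ γ → GH.ok σ (primBG σ z γ W)) →
      GH.ok σ (f.sum fun γ m => m • primBG σ z γ W) := by
    intro W f hf IH x hx
    have hx' := Finsupp.support_finsetSum hx
    simp only [Finset.mem_biUnion] at hx'
    obtain ⟨γ, hγ, hγx⟩ := hx'
    exact IH γ (hf γ hγ) x (Finsupp.support_smul hγx)
  intro W
  induction W with
  | nil =>
    intro β hβ x hx
    cases β with
    | pow k => rw [hsingle _ _ _ hx]; trivial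
    | invPow k =>
      cases k with
      | zero => rw [hsingle _ _ _ hx]; trivial
      | succ k => rw [hsingle _ _ _ hx]; trivial
    | invLet a k =>
      cases k with
      | zero => rw [hsingle _ _ _ hx]; trivial
      | succ k => rw [hsingle _ _ _ hx]; exact hβ
  | cons c W IHW =>
    intro β hβ x hx
    have hcase : ∀ (y : GH α) (q r : K) (β₀ : GB α), GB.ok σ β₀ → GB.ok σ y.1 →
        x ∈ (Finsupp.single y q + r • (mulG σ β₀ c).sum (fun γ m => m • primBG σ z γ W)).support → GB.ok σ x.1 := by
      intro y q r β₀ hβ₀ hy hx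
      rcases Finset.mem_union.1 (Finsupp.support_add hx) with h | h
      · rw [hsingle _ _ _ h]; exact hy
      · exact hrec W (mulG σ β₀ c) (mulG_ok β₀ hβ₀ c) (fun γ hγ => IHW γ hγ) x (Finsupp.support_smul h)
    cases β with
    | pow k =>
      refine hcase (GB.pow (k + 1), c :: W) ((k + 1 : K)⁻¹) (-((k + 1 : K)⁻¹)) (GB.pow (k + 1)) trivial trivial ?_
      rw [neg_smul, ← sub_eq_add_neg]; exact hx
    | invPow k =>
      cases k with
      | zero => rw [hsingle _ _ _ hx]; trivial
      | succ k => exact hcase (GB.invPow k, c :: W) (-((k + 1 : K)⁻¹)) ((k + 1 : K)⁻¹) (GB.invPow k) trivial trivial hx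
    | invLet a k =>
      cases k with
      | zero => rw [hsingle _ _ _ hx]; trivial
      | succ k =>
        refine hcase (GB.invLet a k, c :: W) ((k + 1 : K)⁻¹) (-((k + 1 : K)⁻¹)) (GB.invLet a k) hβ hβ ?_
        rw [neg_smul, ← sub_eq_add_neg]; exact hx

omit hz hσz in
/-- The primitive of an admissible element is admissible. [folklore] -/
theorem primG_ok {K : Type*} [CommRing K] [Inv K] {σ : α → K} {z : α} {F : GH α →₀ K} (hF : GH.ok σ F) :
    GH.ok σ (primG σ z F) := by
  classical
  intro x hx
  unfold primG at hx
  have hx' := Finsupp.support_finsetSum hx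
  simp only [Finset.mem_biUnion] at hx'
  obtain ⟨y, hy, hyx⟩ := hx'
  exact primBG_ok y.2 y.1 (hF y hy) x (Finsupp.support_smul hyx)

/-- **Evaluation of a convergent integral by the primitive and the regularised boundary values**:
`∫₀¹ hevG F = Reg_{t=1} hevG(primG F) - Reg_{t=0} hevG(primG F)`. [folklore] -/
theorem integral_hevG_eq {F : GH α →₀ ℝ} (hF : GH.ok σ F) (hint : IntegrableOn (hevG σ z F) (Ioo 0 1) volume) :
    ∫ t in Ioo (0 : ℝ) 1, hevG σ z F t = reg1G hz hσz (primG σ z F) - reg0G σ z (primG σ z F) := by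
  set G := primG σ z F with hG
  have hGok : GH.ok σ G := primG_ok hF
  set f₀ : ℝ → ℝ := (Ioo (0 : ℝ) 1).indicator (hevG σ z F) with hf₀
  have hf₀i : Integrable f₀ volume := hint.integrable_indicator measurableSet_Ioo
  set P : ℝ → ℝ := fun b => ∫ x in (0 : ℝ)..b, f₀ x with hP
  have hPc : Continuous P := continuous_primitive (fun a b => hf₀i.intervalIntegrable) 0
  -- the fundamental theorem of calculus on `[a,b] ⊂ (0,1)`
  have hftc : ∀ a ∈ Ioo (0 : ℝ) 1, ∀ b ∈ Ioo (0 : ℝ) 1, hevG σ z G b - hevG σ z G a = P b - P a := by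
    intro a ha b hb
    have hsub : uIcc a b ⊆ Ioo 0 1 := by
      intro x hx
      rw [mem_uIcc] at hx
      rcases hx with ⟨h1, h2⟩ | ⟨h1, h2⟩
      · exact ⟨ha.1.trans_le h1, h2.trans_lt hb.2⟩
      · exact ⟨hb.1.trans_le h1, h2.trans_lt ha.2⟩
    have h1 : ∫ x in a..b, hevG σ z F x = hevG σ z G b - hevG σ z G a :=
      integral_eq_sub_of_hasDerivAt (fun x hx => hasDerivAt_hevG_primG hz hσz hF (hsub hx))
        (((continuousOn_hevG hz hσz F).mono hsub).intervalIntegrable)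
    have h2 : ∫ x in a..b, f₀ x = ∫ x in a..b, hevG σ z F x :=
      intervalIntegral.integral_congr fun x hx => by rw [hf₀, indicator_of_mem (hsub hx)]
    rw [← h1, ← h2, hP, intervalIntegral.integral_interval_sub_left hf₀i.intervalIntegrable hf₀i.intervalIntegrable]
  have hhalf : (1 / 2 : ℝ) ∈ Ioo (0 : ℝ) 1 := by constructor <;> norm_num
  -- the limit at `0⁺`
  have hlim0 : Tendsto (hevG σ z G) (𝓝[>] 0) (𝓝 (hevG σ z G (1 / 2) - P (1 / 2) + P 0)) := by
    have hc : Continuous fun a : ℝ => hevG σ z G (1 / 2) - P (1 / 2) + P a := continuous_const.add hPc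
    have ht : Tendsto (fun a => hevG σ z G (1 / 2) - P (1 / 2) + P a) (𝓝[>] 0)
        (𝓝 (hevG σ z G (1 / 2) - P (1 / 2) + P 0)) := (hc.tendsto 0).mono_left nhdsWithin_le_nhds
    refine ht.congr' ?_
    filter_upwards [Ioo_mem_nhdsGT (zero_lt_one' ℝ)] with a ha
    linarith [hftc a ha (1 / 2) hhalf]
  have hP0 : P 0 = 0 := by rw [hP]; exact intervalIntegral.integral_same
  have hreg0 : hevG σ z G (1 / 2) - P (1 / 2) + P 0 = reg0G σ z G := (hasRegValue_hevG hz hσz hGok).eq_of_tendsto hlim0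
  -- the limit at `1⁻`
  have hlim1 : Tendsto (fun s => hevG σ z G (1 - s)) (𝓝[>] 0) (𝓝 (hevG σ z G (1 / 2) - P (1 / 2) + P 1)) := by
    have hc : Continuous fun s : ℝ => hevG σ z G (1 / 2) - P (1 / 2) + P (1 - s) :=
      continuous_const.add (hPc.comp (continuous_const.sub continuous_id))
    have ht : Tendsto (fun s => hevG σ z G (1 / 2) - P (1 / 2) + P (1 - s)) (𝓝[>] 0)
        (𝓝 (hevG σ z G (1 / 2) - P (1 / 2) + P 1)) := by
      have := (hc.tendsto 0).mono_left (nhdsWithin_le_nhds (s := Ioi (0 : ℝ)))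
      simpa using this
    refine ht.congr' ?_
    filter_upwards [Ioo_mem_nhdsGT (zero_lt_one' ℝ)] with s hs
    have hs' : 1 - s ∈ Ioo (0 : ℝ) 1 := ⟨by linarith [hs.2], by linarith [hs.1]⟩
    linarith [hftc (1 - s) hs' (1 / 2) hhalf]
  have hreg1 : hevG σ z G (1 / 2) - P (1 / 2) + P 1 = reg1G hz hσz G :=
    (hasRegValue_hevG_one_sub hz hσz hGok).eq_of_tendsto hlim1
  -- the integral
  have hzero : ∀ x, x ∉ Ioc (0 : ℝ) 1 → f₀ x = 0 := fun x hx => by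
    rw [hf₀]; exact indicator_of_notMem (fun h => hx (Ioo_subset_Ioc_self h)) _
  have hI : ∫ t in Ioo (0 : ℝ) 1, hevG σ z F t = P 1 := by
    rw [hP]
    dsimp only
    rw [intervalIntegral.integral_of_le zero_le_one, setIntegral_eq_integral_of_forall_compl_eq_zero hzero, hf₀,
      MeasureTheory.integral_indicator measurableSet_Ioo]
  rw [hI, ← hreg0, ← hreg1, hP0]
  ring

end GTheoremF1

/-! ### Families: coefficients that are functions of parameters -/

section Family

variable [DecidableEq α] {D : Type*} (σA : α → D → ℝ) (z : α)

/-- The alphabet at the parameter `r`. [folklore] -/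
def σat (σA : α → D → ℝ) (r : D) : α → ℝ := fun a => σA a r

omit [DecidableEq α] in
/-- Unfolding of `σat`. [folklore] -/
@[simp] theorem σat_apply (r : D) (a : α) : σat σA r a = σA a r := rfl

/-- Evaluation of parameter-dependent coefficients at a parameter. [folklore] -/
def evA (r : D) : (D → ℝ) →+* ℝ := Pi.evalRingHom (fun _ : D => ℝ) r

omit [DecidableEq α] in
/-- Unfolding of `evA`. [folklore] -/
@[simp] theorem evA_apply (r : D) (f : D → ℝ) : evA r f = f r := rfl

/-- Evaluation of a finitely supported family of parameter-dependent coefficients. [folklore] -/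
def evF {X : Type*} (r : D) : (X →₀ (D → ℝ)) →+ (X →₀ ℝ) :=
  Finsupp.mapRange.addMonoidHom (evA r).toAddMonoidHom

omit [DecidableEq α] in
/-- Unfolding of `evF`. [folklore] -/
@[simp] theorem evF_apply {X : Type*} (r : D) (v : X →₀ (D → ℝ)) (x : X) : evF r v x = v x r := rfl

omit [DecidableEq α] in
/-- Evaluation of a single. [folklore] -/
@[simp] theorem evF_single {X : Type*} (r : D) (x : X) (f : D → ℝ) :
    evF r (Finsupp.single x f) = Finsupp.single x (f r) := by
  unfold evF; simp

omit [DecidableEq α] in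
/-- Evaluation commutes with scalars. [folklore] -/
theorem evF_smul {X : Type*} (r : D) (f : D → ℝ) (v : X →₀ (D → ℝ)) : evF r (f • v) = f r • evF r v := by
  ext x; simp

omit [DecidableEq α] in
/-- Evaluation of a `Finsupp.sum`. [folklore] -/
theorem evF_finsupp_sum {X Y : Type*} (r : D) (g : Y →₀ (D → ℝ)) (h : Y → (D → ℝ) → X →₀ (D → ℝ)) :
    evF r (g.sum h) = g.sum fun y m => evF r (h y m) :=
  map_finsuppSum (evF r) g h

variable {σA}
variable (hZu : ∀ c, σA c = 0 ∨ ∀ r, σA c r ≠ 0) (hEu : ∀ a c, σA c = σA a ∨ ∀ r, σA c r ≠ σA a r)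
include hZu hEu

omit [DecidableEq α] hEu in
/-- Uniform zero pattern: `σ c = 0` as functions iff at any parameter. [folklore] -/
theorem eqA_zero_iff (c : α) (r : D) : σA c r = 0 ↔ σA c = 0 := by
  rcases hZu c with h | h
  · exact ⟨fun _ => h, fun _ => by rw [h]; rfl⟩
  · exact ⟨fun h0 => absurd h0 (h r), fun h0 => by rw [h0]; rfl⟩

omit [DecidableEq α] hZu in
/-- Uniform coincidence pattern. [folklore] -/
theorem eqA_iff (a c : α) (r : D) : σA c r = σA a r ↔ σA c = σA a := by
  rcases hEu a c with h | h
  · exact ⟨fun _ => h, fun _ => by rw [h]⟩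
  · exact ⟨fun h0 => absurd h0 (h r), fun h0 => by rw [h0]⟩

omit [DecidableEq α] in
/-- **Evaluation commutes with the multiplication table.** [folklore] -/
theorem evF_mulG (r : D) : ∀ (β : GB α) (c : α), evF r (mulG σA β c) = mulG (σat σA r) β c := by
  intro β c
  have hz := eqA_zero_iff hZu c r
  induction β with
  | pow k =>
    induction k with
    | zero =>
      by_cases hc : σA c = 0
      · have hc' : σat σA r c = 0 := hz.2 hc
        simp only [mulG, if_pos hc, if_pos hc', evF_single]; rfl
      · have hc' : ¬σat σA r c = 0 := fun h => hc (hz.1 h)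
        simp only [mulG, if_neg hc, if_neg hc', evF_single]; rfl
    | succ k IH =>
      by_cases hc : σA c = 0
      · have hc' : σat σA r c = 0 := hz.2 hc
        simp only [mulG, if_pos hc, if_pos hc', evF_single]; rfl
      · have hc' : ¬σat σA r c = 0 := fun h => hc (hz.1 h)
        simp only [mulG, if_neg hc, if_neg hc', map_sub, evF_smul, evF_single, IH]
        rfl
  | invPow k =>
    induction k with
    | zero =>
      by_cases hc : σA c = 0
      · have hc' : σat σA r c = 0 := hz.2 hc
        simp only [mulG, if_pos hc, if_pos hc', evF_single]; rfl
      · have hc' : ¬σat σA r c = 0 := fun h => hc (hz.1 h)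
        simp only [mulG, if_neg hc, if_neg hc', map_add, evF_smul, evF_single]
        rfl
    | succ k IH =>
      by_cases hc : σA c = 0
      · have hc' : σat σA r c = 0 := hz.2 hc
        simp only [mulG, if_pos hc, if_pos hc', evF_single]; rfl
      · have hc' : ¬σat σA r c = 0 := fun h => hc (hz.1 h)
        simp only [mulG, if_neg hc, if_neg hc', map_add, evF_smul, evF_single, IH]
        rfl
  | invLet a k =>
    have he := eqA_iff hEu a c r
    induction k with
    | zero =>
      by_cases hc : σA c = 0
      · have hc' : σat σA r c = 0 := hz.2 hc
        simp only [mulG, if_pos hc, if_pos hc', map_add, evF_smul, evF_single]; rfl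
      · have hc' : ¬σat σA r c = 0 := fun h => hc (hz.1 h)
        by_cases hca : σA c = σA a
        · have hca' : σat σA r c = σat σA r a := he.2 hca
          simp only [mulG, if_neg hc, if_neg hc', if_pos hca, if_pos hca', evF_single]; rfl
        · have hca' : ¬σat σA r c = σat σA r a := fun h => hca (he.1 h)
          simp only [mulG, if_neg hc, if_neg hc', if_neg hca, if_neg hca', map_sub, evF_smul, evF_single]
          rfl
    | succ k IH =>
      by_cases hc : σA c = 0
      · have hc' : σat σA r c = 0 := hz.2 hc
        simp only [mulG, if_pos hc, if_pos hc', map_add, evF_smul, evF_single, IH]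
        rfl
      · have hc' : ¬σat σA r c = 0 := fun h => hc (hz.1 h)
        by_cases hca : σA c = σA a
        · have hca' : σat σA r c = σat σA r a := he.2 hca
          simp only [mulG, if_neg hc, if_neg hc', if_pos hca, if_pos hca', evF_single]; rfl
        · have hca' : ¬σat σA r c = σat σA r a := fun h => hca (he.1 h)
          simp only [mulG, if_neg hc, if_neg hc', if_neg hca, if_neg hca', map_sub, evF_smul, evF_single, IH]
          rfl

omit [DecidableEq α] in
/-- **Evaluation commutes with the primitives.** [folklore] -/
theorem evF_primBG (r : D) : ∀ (W : List α) (β : GB α),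
    evF r (primBG σA z β W) = primBG (σat σA r) z β W := by
  have hinv : ∀ k : ℕ, ((k + 1 : D → ℝ)⁻¹) r = (k + 1 : ℝ)⁻¹ := fun k => by
    simp [Pi.inv_apply]
  have hrec : ∀ (W : List α) (f : GB α →₀ (D → ℝ)),
      (∀ γ, evF r (primBG σA z γ W) = primBG (σat σA r) z γ W) →
      evF r (f.sum fun γ m => m • primBG σA z γ W) =
        (evF r f).sum fun γ m => m • primBG (σat σA r) z γ W := by
    intro W f IH
    rw [evF_finsupp_sum]
    unfold evF
    rw [Finsupp.mapRange.addMonoidHom_apply, Finsupp.sum_mapRange_index (fun _ => by simp)]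
    refine Finsupp.sum_congr fun γ _ => ?_
    have := IH γ
    unfold evF at this
    rw [← this]
    ext x
    simp
  intro W
  induction W with
  | nil =>
    intro β
    cases β with
    | pow k => simp only [primBG, evF_single, hinv]
    | invPow k =>
      cases k with
      | zero => simp only [primBG, evF_single]; rfl
      | succ k => simp only [primBG, evF_single, Pi.neg_apply, hinv]
    | invLet a k =>
      cases k with
      | zero => simp only [primBG, evF_single]; rfl
      | succ k => simp only [primBG, evF_single, hinv]
  | cons c W IHW =>
    intro β
    cases β with
    | pow k =>
      simp only [primBG, map_sub, evF_single, evF_smul, hinv, hrec W _ IHW, evF_mulG hZu hEu]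
    | invPow k =>
      cases k with
      | zero => simp only [primBG, evF_single]; rfl
      | succ k => simp only [primBG, map_add, evF_single, evF_smul, Pi.neg_apply, hinv, hrec W _ IHW, evF_mulG hZu hEu]
    | invLet a k =>
      cases k with
      | zero => simp only [primBG, evF_single]; rfl
      | succ k => simp only [primBG, map_sub, evF_single, evF_smul, hinv, hrec W _ IHW, evF_mulG hZu hEu]

omit [DecidableEq α] in
/-- **Evaluation commutes with `primG`.** [folklore] -/
theorem evF_primG (r : D) (F : GH α →₀ (D → ℝ)) :
    evF r (primG σA z F) = primG (σat σA r) z (evF r F) := by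
  unfold primG
  rw [evF_finsupp_sum]
  unfold evF
  rw [Finsupp.mapRange.addMonoidHom_apply, Finsupp.sum_mapRange_index (fun _ => by simp)]
  refine Finsupp.sum_congr fun x _ => ?_
  have := evF_primBG (z := z) hZu hEu r x.2 x.1
  unfold evF at this
  rw [← this]
  ext y
  simp

omit [DecidableEq α] hZu hEu in
/-- Admissibility is inherited by the evaluations. [folklore] -/
theorem ok_evF {F : GH α →₀ (D → ℝ)} (hF : GH.ok σA F) (hZ' : ∀ a, σA a ≠ 0 → ∀ r, σA a r ≠ 0) (r : D) :
    GH.ok (σat σA r) (evF r F) := by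
  intro x hx
  have hx' : x ∈ F.support := by
    rw [Finsupp.mem_support_iff] at hx ⊢
    intro h; apply hx; simp [h]
  have h := hF x hx'
  rcases x with ⟨β, W⟩
  cases β with
  | pow k => trivial
  | invPow k => trivial
  | invLet a k => exact hZ' a h r

/-! #### Membership of the coefficients in a subalgebra of functions -/

variable (𝒢 : Subalgebra ℚ (D → ℝ))
  (hGσ : ∀ a, σA a ∈ 𝒢) (hGinv : ∀ a, σA a ≠ 0 → (σA a)⁻¹ ∈ 𝒢)
  (hGdiff : ∀ a c, σA c ≠ σA a → (σA c - σA a)⁻¹ ∈ 𝒢)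
include hGσ hGinv hGdiff

omit hZu hEu in
/-- All coefficients of a finitely supported family lie in `𝒢`. [folklore] -/
def CoefIn {X : Type*} (v : X →₀ (D → ℝ)) : Prop := ∀ x, v x ∈ 𝒢

omit [DecidableEq α] hZu hEu hGσ hGinv hGdiff in
/-- `0` has coefficients in `𝒢`. [folklore] -/
theorem coefIn_zero {X : Type*} : CoefIn 𝒢 (0 : X →₀ (D → ℝ)) := fun _ => Subalgebra.zero_mem _

omit [DecidableEq α] hZu hEu hGσ hGinv hGdiff in
/-- Sums keep coefficients in `𝒢`. [folklore] -/
theorem CoefIn.add {X : Type*} {v w : X →₀ (D → ℝ)} (hv : CoefIn 𝒢 v) (hw : CoefIn 𝒢 w) : CoefIn 𝒢 (v + w) :=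
  fun x => by rw [Finsupp.add_apply]; exact Subalgebra.add_mem _ (hv x) (hw x)

omit [DecidableEq α] hZu hEu hGσ hGinv hGdiff in
/-- Differences keep coefficients in `𝒢`. [folklore] -/
theorem CoefIn.sub {X : Type*} {v w : X →₀ (D → ℝ)} (hv : CoefIn 𝒢 v) (hw : CoefIn 𝒢 w) : CoefIn 𝒢 (v - w) :=
  fun x => by rw [Finsupp.sub_apply]; exact Subalgebra.sub_mem _ (hv x) (hw x)

omit [DecidableEq α] hZu hEu hGσ hGinv hGdiff in
/-- Multiples by elements of `𝒢` keep coefficients in `𝒢`. [folklore] -/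
theorem CoefIn.smul {X : Type*} {f : D → ℝ} (hf : f ∈ 𝒢) {v : X →₀ (D → ℝ)} (hv : CoefIn 𝒢 v) : CoefIn 𝒢 (f • v) :=
  fun x => by rw [Finsupp.smul_apply, smul_eq_mul]; exact Subalgebra.mul_mem _ hf (hv x)

omit [DecidableEq α] hZu hEu hGσ hGinv hGdiff in
/-- Singles with coefficient in `𝒢`. [folklore] -/
theorem coefIn_single {X : Type*} [DecidableEq X] (x : X) {f : D → ℝ} (hf : f ∈ 𝒢) : CoefIn 𝒢 (Finsupp.single x f) := by
  intro y
  by_cases hxy : x = y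
  · subst hxy; rwa [Finsupp.single_eq_same]
  · rw [Finsupp.single_apply, if_neg hxy]; exact Subalgebra.zero_mem _

omit [DecidableEq α] hZu hEu hGσ hGinv hGdiff in
/-- Finite sums keep coefficients in `𝒢`. [folklore] -/
theorem coefIn_finset_sum {X ι : Type*} (s : Finset ι) {v : ι → X →₀ (D → ℝ)} (h : ∀ i ∈ s, CoefIn 𝒢 (v i)) :
    CoefIn 𝒢 (∑ i ∈ s, v i) := by
  classical
  induction s using Finset.induction_on with
  | empty => simpa using coefIn_zero 𝒢
  | insert i s hi IH =>
    rw [Finset.sum_insert hi]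
    exact (h i (Finset.mem_insert_self i s)).add 𝒢 (IH fun j hj => h j (Finset.mem_insert_of_mem hj))

omit [DecidableEq α] hZu hEu hGσ hGinv hGdiff in
/-- `Finsupp.sum`s keep coefficients in `𝒢`. [folklore] -/
theorem coefIn_finsupp_sum {X Y : Type*} {g : Y →₀ (D → ℝ)} (hg : CoefIn 𝒢 g) {h : Y → (D → ℝ) → X →₀ (D → ℝ)}
    (hh : ∀ y, ∀ f ∈ 𝒢, CoefIn 𝒢 (h y f)) : CoefIn 𝒢 (g.sum h) := by
  rw [Finsupp.sum]
  exact coefIn_finset_sum 𝒢 _ fun y _ => hh y (g y) (hg y)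

omit [DecidableEq α] hZu hEu hGσ hGinv hGdiff in
/-- The constants `1` and `(k+1)⁻¹` lie in `𝒢`. [folklore] -/
theorem inv_natCast_succ_mem (k : ℕ) : ((k + 1 : D → ℝ)⁻¹) ∈ 𝒢 := by
  have : ((k + 1 : D → ℝ)⁻¹) = algebraMap ℚ (D → ℝ) ((k + 1 : ℚ)⁻¹) := by
    funext r; simp
  rw [this]; exact Subalgebra.algebraMap_mem _ _

omit hZu hEu in
/-- The coefficients of the multiplication table lie in `𝒢`. [folklore] -/
theorem coefIn_mulG : ∀ (β : GB α), GB.ok σA β → ∀ (c : α), CoefIn 𝒢 (mulG σA β c) := by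
  have h1 : (1 : D → ℝ) ∈ 𝒢 := Subalgebra.one_mem _
  intro β hβ c
  induction β with
  | pow k =>
    induction k with
    | zero =>
      simp only [mulG]; split_ifs
      · exact coefIn_single 𝒢 _ h1
      · exact coefIn_single 𝒢 _ h1
    | succ k IH =>
      simp only [mulG]; split_ifs with hc
      · exact coefIn_single 𝒢 _ h1
      · exact ((IH trivial).smul 𝒢 (hGσ c)).sub 𝒢 (coefIn_single 𝒢 _ h1)
  | invPow k =>
    induction k with
    | zero =>
      simp only [mulG]; split_ifs with hc
      · exact coefIn_single 𝒢 _ h1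
      · exact ((coefIn_single 𝒢 _ h1).add 𝒢 (coefIn_single 𝒢 _ h1)).smul 𝒢 (hGinv c hc)
    | succ k IH =>
      simp only [mulG]; split_ifs with hc
      · exact coefIn_single 𝒢 _ h1
      · exact ((coefIn_single 𝒢 _ h1).add 𝒢 (IH trivial)).smul 𝒢 (hGinv c hc)
  | invLet a k =>
    have ha : σA a ≠ 0 := hβ
    induction k with
    | zero =>
      simp only [mulG]; split_ifs with hc hca
      · exact ((coefIn_single 𝒢 _ h1).add 𝒢 (coefIn_single 𝒢 _ h1)).smul 𝒢 (hGinv a ha)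
      · exact coefIn_single 𝒢 _ h1
      · exact ((coefIn_single 𝒢 _ h1).sub 𝒢 (coefIn_single 𝒢 _ h1)).smul 𝒢 (hGdiff a c hca)
    | succ k IH =>
      simp only [mulG]; split_ifs with hc hca
      · exact ((IH ha).add 𝒢 (coefIn_single 𝒢 _ h1)).smul 𝒢 (hGinv a ha)
      · exact coefIn_single 𝒢 _ h1
      · exact ((coefIn_single 𝒢 _ h1).sub 𝒢 (IH ha)).smul 𝒢 (hGdiff a c hca)

omit hZu hEu in
/-- The coefficients of the primitives lie in `𝒢`. [folklore] -/
theorem coefIn_primBG : ∀ (W : List α) (β : GB α), GB.ok σA β → CoefIn 𝒢 (primBG σA z β W) := by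
  have h1 : (1 : D → ℝ) ∈ 𝒢 := Subalgebra.one_mem _
  have hk : ∀ k : ℕ, ((k + 1 : D → ℝ)⁻¹) ∈ 𝒢 := inv_natCast_succ_mem 𝒢
  have hrec : ∀ (W : List α) (β₀ : GB α), GB.ok σA β₀ → ∀ (c : α),
      (∀ γ, GB.ok σA γ → CoefIn 𝒢 (primBG σA z γ W)) →
      CoefIn 𝒢 ((mulG σA β₀ c).sum fun γ m => m • primBG σA z γ W) := by
    intro W β₀ hβ₀ c IH
    rw [Finsupp.sum]
    refine coefIn_finset_sum 𝒢 _ fun γ hγ => ?_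
    exact (IH γ (mulG_ok β₀ hβ₀ c γ hγ)).smul 𝒢 (coefIn_mulG 𝒢 hGσ hGinv hGdiff β₀ hβ₀ c γ)
  intro W
  induction W with
  | nil =>
    intro β hβ
    cases β with
    | pow k => exact coefIn_single 𝒢 _ (hk k)
    | invPow k =>
      cases k with
      | zero => exact coefIn_single 𝒢 _ h1
      | succ k => exact coefIn_single 𝒢 _ (Subalgebra.neg_mem _ (hk k))
    | invLet a k =>
      cases k with
      | zero => exact coefIn_single 𝒢 _ h1
      | succ k => exact coefIn_single 𝒢 _ (hk k)
  | cons c W IHW =>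
    intro β hβ
    cases β with
    | pow k => exact (coefIn_single 𝒢 _ (hk k)).sub 𝒢 ((hrec W (GB.pow (k + 1)) trivial c IHW).smul 𝒢 (hk k))
    | invPow k =>
      cases k with
      | zero => exact coefIn_single 𝒢 _ h1
      | succ k => exact (coefIn_single 𝒢 _ (Subalgebra.neg_mem _ (hk k))).add 𝒢 ((hrec W (GB.invPow k) trivial c IHW).smul 𝒢 (hk k))
    | invLet a k =>
      cases k with
      | zero => exact coefIn_single 𝒢 _ h1
      | succ k => exact (coefIn_single 𝒢 _ (hk k)).sub 𝒢 ((hrec W (GB.invLet a k) hβ c IHW).smul 𝒢 (hk k))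

omit hZu hEu in
/-- The coefficients of `primG F` lie in `𝒢` when those of `F` do. [folklore] -/
theorem coefIn_primG {F : GH α →₀ (D → ℝ)} (hF : GH.ok σA F) (hFc : CoefIn 𝒢 F) : CoefIn 𝒢 (primG σA z F) := by
  unfold primG
  rw [Finsupp.sum]
  refine coefIn_finset_sum 𝒢 _ fun x hx => ?_
  exact (coefIn_primBG z 𝒢 hGσ hGinv hGdiff x.2 x.1 (hF x hx)).smul 𝒢 (hFc x)

end Family

/-! ### Families: the regularised values as functions of the parameters -/

section FamilyValues

open Finset

variable [DecidableEq α] {D : Type*} {σA : α → D → ℝ} (z o : α)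
  (hZu : ∀ c, σA c = 0 ∨ ∀ r, σA c r ≠ 0) (hEu : ∀ a c, σA c = σA a ∨ ∀ r, σA c r ≠ σA a r)
  (𝒢 : Subalgebra ℚ (D → ℝ))
  (hGσ : ∀ a, σA a ∈ 𝒢) (hGinv : ∀ a, σA a ≠ 0 → (σA a)⁻¹ ∈ 𝒢)
  (hGdiff : ∀ a c, σA c ≠ σA a → (σA c - σA a)⁻¹ ∈ 𝒢)

omit [DecidableEq α] in
/-- Rational real constants give constant functions in `𝒢`. [folklore] -/
theorem const_mem_of_isRat {x : ℝ} (hx : IsRat x) : (fun _ : D => x) ∈ 𝒢 := by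
  obtain ⟨q, rfl⟩ := hx
  have : (fun _ : D => ((q : ℚ) : ℝ)) = algebraMap ℚ (D → ℝ) q := by funext r; simp
  rw [this]; exact Subalgebra.algebraMap_mem _ _

omit [DecidableEq α] in
/-- `ℚ`-multiples inside `𝒢`. [folklore] -/
theorem ratCast_mul_mem (q : ℚ) {f : D → ℝ} (hf : f ∈ 𝒢) : (fun r => (q : ℝ) * f r) ∈ 𝒢 := by
  have : (fun r => (q : ℝ) * f r) = q • f := by funext r; simp [Rat.smul_def]
  rw [this]; exact Subalgebra.smul_mem _ hf q

include hZu hGinv in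
omit [DecidableEq α] in
/-- **The power-series coefficients of layer III are in `𝒢`** (as functions of the parameters):
polynomials in the `1/σ_c`. [folklore] -/
theorem coeff_mem : ∀ (u : List α) (m : ℕ), (fun r => coeff (σat σA r) u m) ∈ 𝒢 := by
  intro u
  induction u with
  | nil =>
    intro m
    have : (fun r => coeff (σat σA r) ([] : List α) m) = fun _ => if m = 0 then (1 : ℝ) else 0 := by
      funext r; rw [coeff_nil]
    rw [this]
    split_ifs
    · exact Subalgebra.one_mem _
    · exact Subalgebra.zero_mem _
  | cons c w IH =>
    intro m
    cases m with
    | zero =>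
      have : (fun r => coeff (σat σA r) (c :: w) 0) = fun _ => (0 : ℝ) := by funext r; rfl
      rw [this]; exact Subalgebra.zero_mem _
    | succ m =>
      have hm : IsRat ((m + 1 : ℝ)⁻¹) := (isRat_natCast (m + 1)).inv |> fun h => by simpa using h
      rcases hZu c with hc | hc
      · have : (fun r => coeff (σat σA r) (c :: w) (m + 1)) =
            fun r => coeff (σat σA r) w (m + 1) * (m + 1 : ℝ)⁻¹ := by
          funext r
          have hcr : σat σA r c = 0 := by show σA c r = 0; rw [hc]; rfl
          rw [coeff_cons_succ_of_eq_zero hcr w m, div_eq_mul_inv]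
        rw [this]
        exact Subalgebra.mul_mem _ (IH (m + 1)) (const_mem_of_isRat 𝒢 hm)
      · by_cases hc0 : σA c = 0
        · have : (fun r => coeff (σat σA r) (c :: w) (m + 1)) = 0 :=
            funext fun r => absurd (congrFun hc0 r) (hc r)
          rw [this]; exact Subalgebra.zero_mem _
        have : (fun r => coeff (σat σA r) (c :: w) (m + 1)) =
            fun r => (∑ jk ∈ antidiagonal m, ((σA c)⁻¹ r) ^ (jk.1 + 1) * coeff (σat σA r) w jk.2) * (m + 1 : ℝ)⁻¹ := by
          funext r
          have hcr : σat σA r c ≠ 0 := hc r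
          rw [coeff_cons_succ_of_ne_zero hcr w m, div_eq_mul_inv]
          congr 1
          refine Finset.sum_congr rfl fun jk _ => ?_
          simp [one_div, inv_pow]
        rw [this]
        refine Subalgebra.mul_mem _ ?_ (const_mem_of_isRat 𝒢 hm)
        have hsum : (fun r => ∑ jk ∈ antidiagonal m, ((σA c)⁻¹ r) ^ (jk.1 + 1) * coeff (σat σA r) w jk.2) =
            ∑ jk ∈ antidiagonal m, ((σA c)⁻¹) ^ (jk.1 + 1) * (fun r => coeff (σat σA r) w jk.2) := by
          funext r; simp [Finset.sum_apply]
        rw [hsum]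
        exact Subalgebra.sum_mem _ fun jk _ => Subalgebra.mul_mem _ (Subalgebra.pow_mem _ (hGinv c hc0) _) (IH jk.2)

include hZu hGinv in
/-- The Taylor coefficients `regCoeff` of the regularised factors are in `𝒢`. [folklore] -/
theorem regCoeff_mem (W : List α) (m : ℕ) : (fun r => regCoeff (σat σA r) z W m) ∈ 𝒢 := by
  have : (fun r => regCoeff (σat σA r) z W m) =
      ∑ u ∈ (Shuffle.regEnd z W).support, fun r => ((Shuffle.regEnd z W u : ℚ) : ℝ) * coeff (σat σA r) u m := by
    funext r
    simp only [regCoeff, Shuffle.pair, Finsupp.sum, Finset.sum_apply, Rat.smul_def]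
  rw [this]
  exact Subalgebra.sum_mem _ fun u _ => ratCast_mul_mem 𝒢 _ (coeff_mem hZu 𝒢 hGinv u m)

omit [DecidableEq α] in
/-- Powers of Taylor series with coefficients in `𝒢`. [folklore] -/
theorem powTaylor_mem {ψ : D → ℕ → ℝ} (hψ : ∀ i, (fun r => ψ r i) ∈ 𝒢) :
    ∀ (n i : ℕ), (fun r => powTaylor (ψ r) n i) ∈ 𝒢
  | 0, i => by
    have : (fun r => powTaylor (ψ r) 0 i) = fun _ => if i = 0 then (1 : ℝ) else 0 := by funext r; rfl
    rw [this]; split_ifs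
    · exact Subalgebra.one_mem _
    · exact Subalgebra.zero_mem _
  | n + 1, i => by
    have : (fun r => powTaylor (ψ r) (n + 1) i) =
        ∑ jk ∈ antidiagonal i, (fun r => powTaylor (ψ r) n jk.1) * (fun r => ψ r jk.2) := by
      funext r; simp [powTaylor, Finset.sum_apply]
    rw [this]
    exact Subalgebra.sum_mem _ fun jk _ => Subalgebra.mul_mem _ (powTaylor_mem hψ n jk.1) (hψ jk.2)

include hGinv in
omit [DecidableEq α] in
/-- The Taylor coefficients at `0⁺` of the basis functions are in `𝒢`. [folklore] -/
theorem tay0_mem {β : GB α} (hβ : GB.ok σA β) (i : ℕ) : (fun r => tay0 (σat σA r) β i) ∈ 𝒢 := by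
  cases β with
  | pow k =>
    have : (fun r => tay0 (σat σA r) (GB.pow k) i) = fun _ => if i = 0 then (1 : ℝ) else 0 := by funext r; rfl
    rw [this]; split_ifs
    · exact Subalgebra.one_mem _
    · exact Subalgebra.zero_mem _
  | invPow k =>
    have : (fun r => tay0 (σat σA r) (GB.invPow k) i) = fun _ => if i = 0 then (1 : ℝ) else 0 := by funext r; rfl
    rw [this]; split_ifs
    · exact Subalgebra.one_mem _
    · exact Subalgebra.zero_mem _
  | invLet a k =>
    have ha : σA a ≠ 0 := hβ
    have h := powTaylor_mem 𝒢 (ψ := fun r i => 1 / σA a r ^ (i + 1)) (fun i => by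
      have : (fun r => 1 / σA a r ^ (i + 1)) = ((σA a)⁻¹) ^ (i + 1) := by
        funext r; simp [one_div, inv_pow]
      rw [this]; exact Subalgebra.pow_mem _ (hGinv a ha) _) (k + 1) i
    exact h

include hZu hGinv in
/-- **The regularised values at `0⁺` are in `𝒢`** (as functions of the parameters). [folklore] -/
theorem val0_mem {β : GB α} (hβ : GB.ok σA β) (W : List α) :
    (fun r => val0 (σat σA r) z β W) ∈ 𝒢 := by
  unfold val0
  split_ifs with h
  · have : (fun r => ∑ ik ∈ antidiagonal (-zexp0 β).toNat,
        tay0 (σat σA r) β ik.1 * regCoeff (σat σA r) z W ik.2) =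
        ∑ ik ∈ antidiagonal (-zexp0 β).toNat,
          (fun r => tay0 (σat σA r) β ik.1) * (fun r => regCoeff (σat σA r) z W ik.2) := by
      funext r; simp [Finset.sum_apply]
    rw [this]
    exact Subalgebra.sum_mem _ fun ik _ =>
      Subalgebra.mul_mem _ (tay0_mem 𝒢 hGinv hβ ik.1) (regCoeff_mem z hZu 𝒢 hGinv W ik.2)
  · exact Subalgebra.zero_mem _

end FamilyValues

/-! ### Families: the expansion at the top as functions of the parameters -/

section FamilyTop

open Finset

variable [DecidableEq α] {D : Type*} {σA : α → D → ℝ} (z o : α)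
  (hZu : ∀ c, σA c = 0 ∨ ∀ r, σA c r ≠ 0) (hEu : ∀ a c, σA c = σA a ∨ ∀ r, σA c r ≠ σA a r)
  (hoA : σA o = 1)
  (𝒢 : Subalgebra ℚ (D → ℝ))
  (hGσ : ∀ a, σA a ∈ 𝒢) (hGinv : ∀ a, σA a ≠ 0 → (σA a)⁻¹ ∈ 𝒢)
  (hGdiff : ∀ a c, σA c ≠ σA a → (σA c - σA a)⁻¹ ∈ 𝒢)

/-- The unfolding of the top coefficients of the empty word. [folklore] -/
theorem topCoeff_nil_eq {σ : α → ℝ} {z : α} (hz : σ z = 0) (hσz : ∀ c, c ≠ z → 1 ≤ σ c) (m k : ℕ) :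
    topCoeff hz hσz ([] : List α) m k = if k = 0 then (if m = 0 then 1 else 0) else 0 := rfl

/-- **The recursion of the top coefficients** (unfolding of layer IX):
`e_{cW'} = primCoeff (stepCoeff c e_{W'}) |W'| (regTop (cW'))`. [folklore] -/
theorem topCoeff_cons_eq {σ : α → ℝ} {z : α} (hz : σ z = 0) (hσz : ∀ c, c ≠ z → 1 ≤ σ c) (c : α) (W' : List α) (m k : ℕ) :
    topCoeff hz hσz (c :: W') m k =
      primCoeff (stepCoeff σ c (topCoeff hz hσz W')) W'.length (regTop hz hσz (c :: W')) m k := by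
  unfold regTop topCoeff
  simp only [topData]
  simp [primCoeff]

/-- The reflected Taylor coefficients as functions of the parameters. [folklore] -/
def reflA (σA : α → D → ℝ) (c : α) (i : ℕ) : D → ℝ := fun r => reflTaylor (σat σA r) c i

open Classical in
/-- Mirror of `stepCoeff` with coefficients of the `regTop V`, functions of the parameters. [folklore] -/
def stepA (σA : α → D → ℝ) (c : α) (e : ℕ → ℕ → (List α →₀ (D → ℝ))) (m k : ℕ) : List α →₀ (D → ℝ) :=
  if σA c = 1 then -e m k else ∑ ij ∈ antidiagonal m, reflA σA c ij.1 • e ij.2 k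

/-- Mirror of `primCoeff`. [folklore] -/
def primA (d : ℕ → ℕ → (List α →₀ (D → ℝ))) (n : ℕ) (c₀ : List α →₀ (D → ℝ)) (m k : ℕ) : List α →₀ (D → ℝ) :=
  if m = 0 then (if k = 0 then c₀ else (fun (_ : D) => (k : ℝ)⁻¹) • d 0 (k - 1))
  else ∑ k' ∈ range (n + 1), (fun (_ : D) => pcoef m k' k) • d m k'

/-- **Mirror of the top coefficients**: `e_W(m,k) = Σ_V (topA W m k)_V · regTop V`. [folklore] -/
def topA (σA : α → D → ℝ) : List α → ℕ → ℕ → (List α →₀ (D → ℝ))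
  | [], m, k => if k = 0 then (if m = 0 then Finsupp.single [] 1 else 0) else 0
  | c :: W', m, k => primA (stepA σA c (topA σA W')) W'.length (Finsupp.single (c :: W') 1) m k

/-- Evaluation of an expansion in the `regTop V` at a parameter. [folklore] -/
def evT {σ : α → ℝ} {z : α} (hz : σ z = 0) (hσz : ∀ c, c ≠ z → 1 ≤ σ c) (r : D) (v : List α →₀ (D → ℝ)) : ℝ :=
  v.sum fun V g => g r * regTop hz hσz V

section evT_lemmas
variable {σ : α → ℝ} {z : α} (hz : σ z = 0) (hσz : ∀ c, c ≠ z → 1 ≤ σ c) (r : D)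

/-- `evT` of a single. [folklore] -/
@[simp] theorem evT_single (V : List α) (g : D → ℝ) : evT hz hσz r (Finsupp.single V g) = g r * regTop hz hσz V := by
  unfold evT; rw [Finsupp.sum_single_index]; simp

/-- `evT` is additive. [folklore] -/
theorem evT_add (v w : List α →₀ (D → ℝ)) : evT hz hσz r (v + w) = evT hz hσz r v + evT hz hσz r w := by
  unfold evT; rw [Finsupp.sum_add_index'] <;> intros <;> simp [add_mul]

/-- `evT 0 = 0`. [folklore] -/
@[simp] theorem evT_zero : evT hz hσz r (0 : List α →₀ (D → ℝ)) = 0 := by simp [evT]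

/-- `evT` as an additive homomorphism. [folklore] -/
def evTHom : (List α →₀ (D → ℝ)) →+ ℝ where
  toFun := evT hz hσz r
  map_zero' := evT_zero hz hσz r
  map_add' := evT_add hz hσz r

/-- `evT` and multiples. [folklore] -/
theorem evT_smul (g : D → ℝ) (v : List α →₀ (D → ℝ)) : evT hz hσz r (g • v) = g r * evT hz hσz r v := by
  unfold evT
  rw [Finsupp.sum_smul_index' (fun _ => by simp)]
  simp only [Finsupp.sum, Finset.mul_sum, Pi.smul_apply', smul_eq_mul, mul_assoc]

/-- `evT` of a negation. [folklore] -/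
theorem evT_neg (v : List α →₀ (D → ℝ)) : evT hz hσz r (-v) = -evT hz hσz r v := map_neg (evTHom hz hσz r) v

/-- `evT` of a finite sum. [folklore] -/
theorem evT_finset_sum {ι : Type*} (s : Finset ι) (v : ι → List α →₀ (D → ℝ)) :
    evT hz hσz r (∑ i ∈ s, v i) = ∑ i ∈ s, evT hz hσz r (v i) := map_sum (evTHom hz hσz r) v s

/-- `evT` of a `Finsupp.sum`. [folklore] -/
theorem evT_finsupp_sum {X N : Type*} [Zero N] (f : X →₀ N) (h : X → N → List α →₀ (D → ℝ)) :
    evT hz hσz r (f.sum h) = f.sum fun x n => evT hz hσz r (h x n) := map_finsuppSum (evTHom hz hσz r) f h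

end evT_lemmas

/-- Evaluation of the mirror of `primCoeff`. [folklore] -/
theorem evT_primA {σ : α → ℝ} {z : α} (hz : σ z = 0) (hσz : ∀ c, c ≠ z → 1 ≤ σ c) (r : D)
    (d : ℕ → ℕ → (List α →₀ (D → ℝ))) (n : ℕ) (c₀ : List α →₀ (D → ℝ)) (m k : ℕ) :
    evT hz hσz r (primA d n c₀ m k) = primCoeff (fun m k => evT hz hσz r (d m k)) n (evT hz hσz r c₀) m k := by
  unfold primA primCoeff
  split_ifs
  · rfl
  · rw [evT_smul]; simp [div_eq_inv_mul]
  · rw [evT_finset_sum]; simp only [evT_smul, mul_comm]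

variable {z o}

include hEu hoA in
omit [DecidableEq α] in
/-- Uniform pattern of the letters at `1`. [folklore] -/
theorem eqA_one_iff (c : α) (r : D) : σA c r = 1 ↔ σA c = 1 := by
  have h := eqA_iff hEu o c r
  have ho1 : σA o r = 1 := by rw [hoA]; rfl
  rw [ho1, hoA] at h
  exact h

include hEu hoA in
/-- Evaluation of the mirror of `stepCoeff`. [folklore] -/
theorem evT_stepA {r : D} (hz : (σat σA r) z = 0) (hσz : ∀ c, c ≠ z → 1 ≤ (σat σA r) c) (c : α)
    (e : ℕ → ℕ → (List α →₀ (D → ℝ))) (m k : ℕ) :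
    evT hz hσz r (stepA σA c e m k) = stepCoeff (σat σA r) c (fun m k => evT hz hσz r (e m k)) m k := by
  unfold stepA stepCoeff
  by_cases hc : σA c = 1
  · have hc' : σat σA r c = 1 := by show σA c r = 1; rw [hc]; rfl
    rw [if_pos hc, if_pos hc', evT_neg]
  · have hc' : ¬σat σA r c = 1 := fun h => hc ((eqA_one_iff hEu hoA c r).1 h)
    rw [if_neg hc, if_neg hc', evT_finset_sum]
    refine Finset.sum_congr rfl fun ij _ => ?_
    rw [evT_smul]; rfl

include hEu hoA in
/-- **The mirror evaluates to the top coefficients.** [folklore] -/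
theorem evT_topA {r : D} (hz : (σat σA r) z = 0) (hσz : ∀ c, c ≠ z → 1 ≤ (σat σA r) c) :
    ∀ (W : List α) (m k : ℕ), topCoeff hz hσz W m k = evT hz hσz r (topA σA W m k) := by
  intro W
  induction W with
  | nil =>
    intro m k
    rw [topCoeff_nil_eq]
    simp only [topA]
    split_ifs with hk hm
    · rw [evT_single]
      have : regTop hz hσz ([] : List α) = 1 := topCoeff_nil_eq hz hσz 0 0
      rw [this]; simp
    · rw [evT_zero]
    · rw [evT_zero]
  | cons c W' IH =>
    intro m k
    rw [topCoeff_cons_eq]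
    simp only [topA]
    rw [evT_primA, evT_single]
    have hIH : (fun m k => evT hz hσz r (stepA σA c (topA σA W') m k)) = stepCoeff (σat σA r) c (topCoeff hz hσz W') := by
      funext m' k'
      rw [evT_stepA hEu hoA hz hσz]
      congr 1
      funext m'' k''
      rw [IH]
    rw [hIH]
    simp

/-! #### Membership -/

omit [DecidableEq α] in
/-- `pcoef` is rational. [folklore] -/
theorem pcoef_isRat (m : ℕ) : ∀ k j : ℕ, IsRat (pcoef m k j)
  | 0, j => by
    unfold pcoef
    exact (isRat_one.div (isRat_natCast m)).ite isRat_zero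
  | k + 1, j => by
    unfold pcoef
    refine IsRat.add ((isRat_one.div (isRat_natCast m)).ite isRat_zero) ?_
    exact (((isRat_natCast k).add isRat_one).div (isRat_natCast m)).mul (pcoef_isRat m k j) |>.neg |> fun h => by
      simpa [sub_eq_add_neg, neg_mul] using h

include hZu hoA hGdiff in
omit [DecidableEq α] in
/-- The reflected Taylor coefficients are in `𝒢`. [folklore] -/
theorem reflA_mem (c : α) (i : ℕ) : reflA σA c i ∈ 𝒢 := by
  unfold reflA reflTaylor
  simp only [σat_apply]
  by_cases hi : i = 0
  · have : (fun r => if i = 0 then (0 : ℝ) else if σA c r = 0 then -1 else (-1) ^ i / (σA c r - 1) ^ i) = 0 := by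
      funext r; simp [hi]
    rw [this]; exact Subalgebra.zero_mem _
  rcases hZu c with hc | hc
  · have : (fun r => if i = 0 then (0 : ℝ) else if σA c r = 0 then -1 else (-1) ^ i / (σA c r - 1) ^ i) = fun _ => (-1 : ℝ) := by
      funext r; rw [if_neg hi, if_pos (by rw [hc]; rfl)]
    rw [this]; exact Subalgebra.neg_mem _ (Subalgebra.one_mem _)
  · by_cases hco : σA c = σA o
    · -- then `σ_c = 1` and the coefficient vanishes
      have : (fun r => if i = 0 then (0 : ℝ) else if σA c r = 0 then -1 else (-1) ^ i / (σA c r - 1) ^ i) = 0 := by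
        funext r
        have h1 : σA c r = 1 := by rw [hco, hoA]; rfl
        rw [if_neg hi, if_neg (hc r), h1, sub_self, zero_pow hi, div_zero]; rfl
      rw [this]; exact Subalgebra.zero_mem _
    · have : (fun r => if i = 0 then (0 : ℝ) else if σA c r = 0 then -1 else (-1) ^ i / (σA c r - 1) ^ i) =
          fun r => ((-1 : ℚ) ^ i : ℚ) * (((σA c - σA o)⁻¹) ^ i) r := by
        funext r
        rw [if_neg hi, if_neg (hc r)]
        have ho1 : σA o r = 1 := by rw [hoA]; rfl
        simp [ho1, div_eq_mul_inv, inv_pow]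
      rw [this]
      exact ratCast_mul_mem 𝒢 _ (Subalgebra.pow_mem _ (hGdiff o c hco) _)

omit [DecidableEq α] in
/-- The mirror of `primCoeff` preserves membership. [folklore] -/
theorem coefIn_primA {d : ℕ → ℕ → (List α →₀ (D → ℝ))} (hd : ∀ m k, CoefIn 𝒢 (d m k)) (n : ℕ)
    {c₀ : List α →₀ (D → ℝ)} (hc₀ : CoefIn 𝒢 c₀) (m k : ℕ) : CoefIn 𝒢 (primA d n c₀ m k) := by
  unfold primA
  split_ifs
  · exact hc₀
  · refine (hd _ _).smul 𝒢 (const_mem_of_isRat 𝒢 ?_)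
    exact (isRat_natCast k).inv
  · exact coefIn_finset_sum 𝒢 _ fun k' _ => (hd _ _).smul 𝒢 (const_mem_of_isRat 𝒢 (pcoef_isRat m k' k))

include hZu hoA hGdiff in
omit [DecidableEq α] in
/-- The mirror of `stepCoeff` preserves membership. [folklore] -/
theorem coefIn_stepA (c : α) {e : ℕ → ℕ → (List α →₀ (D → ℝ))} (he : ∀ m k, CoefIn 𝒢 (e m k)) (m k : ℕ) :
    CoefIn 𝒢 (stepA σA c e m k) := by
  unfold stepA
  split_ifs
  · intro V; rw [Finsupp.neg_apply]; exact Subalgebra.neg_mem _ (he m k V)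
  · exact coefIn_finset_sum 𝒢 _ fun ij _ => (he _ _).smul 𝒢 (reflA_mem hZu hoA 𝒢 hGdiff c ij.1)

include hZu hoA hGdiff in
/-- **The coefficients of the mirror of the top expansion are in `𝒢`.** [folklore] -/
theorem coefIn_topA : ∀ (W : List α) (m k : ℕ), CoefIn 𝒢 (topA σA W m k) := by
  intro W
  induction W with
  | nil =>
    intro m k
    simp only [topA]
    split_ifs
    · exact coefIn_single 𝒢 _ (Subalgebra.one_mem _)
    · exact coefIn_zero 𝒢
    · exact coefIn_zero 𝒢
  | cons c W' IH =>
    intro m k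
    simp only [topA]
    exact coefIn_primA 𝒢 (coefIn_stepA hZu hoA 𝒢 hGdiff c IH) _ (coefIn_single 𝒢 _ (Subalgebra.one_mem _)) m k

/-- Words in the support of the mirror are suffixes of the word. [folklore] -/
theorem suffix_of_mem_support_topA : ∀ (W : List α) (m k : ℕ) (V : List α),
    V ∈ (topA σA W m k).support → V <:+ W := by
  classical
  have hsm : ∀ (g : D → ℝ) (v : List α →₀ (D → ℝ)) (V : List α), V ∈ (g • v).support → V ∈ v.support :=
    fun g v V h => Finsupp.support_smul h
  intro W
  induction W with
  | nil =>
    intro m k V hV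
    simp only [topA] at hV
    split_ifs at hV with h1 h2
    · rw [Finset.mem_singleton.1 (Finsupp.support_single_subset hV)]
    · simp at hV
    · simp at hV
  | cons c W' IH =>
    intro m k V hV
    simp only [topA, primA] at hV
    -- words in `stepA` supports are suffixes of `W'`
    have hstep : ∀ m k V, V ∈ (stepA σA c (topA σA W') m k).support → V <:+ (c :: W') := by
      intro m k V hV
      unfold stepA at hV
      split_ifs at hV
      · rw [Finsupp.support_neg] at hV; exact (IH m k V hV).trans (List.suffix_cons c W')
      · obtain ⟨ij, -, hij⟩ := Finset.mem_biUnion.1 (Finsupp.support_finsetSum hV)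
        exact (IH _ _ V (hsm _ _ _ hij)).trans (List.suffix_cons c W')
    split_ifs at hV with h1 h2
    · rw [Finset.mem_singleton.1 (Finsupp.support_single_subset hV)]
    · exact hstep _ _ V (hsm _ _ _ hV)
    · obtain ⟨k', -, hk'⟩ := Finset.mem_biUnion.1 (Finsupp.support_finsetSum hV)
      exact hstep _ _ V (hsm _ _ _ hk')

/-! #### The regularised values at `1⁻` as functions of the parameters -/

open Classical in
/-- Uniform version of the exponent at `1⁻`. [folklore] -/
def zexp1u (σA : α → D → ℝ) : GB α → ℤ
  | GB.pow _ => 0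
  | GB.invPow _ => 0
  | GB.invLet a k => if σA a = 1 then -(k + 1 : ℤ) else 0

/-- The Taylor coefficients at `1⁻` as functions of the parameters. [folklore] -/
def tay1A (σA : α → D → ℝ) (β : GB α) (i : ℕ) : D → ℝ := fun r => tay1 (σat σA r) β i

/-- **Mirror of the regularised values at `1⁻`**: the coefficients of the `regTop V`. [folklore] -/
def val1A (σA : α → D → ℝ) (β : GB α) (W : List α) : List α →₀ (D → ℝ) :=
  if zexp1u σA β ≤ 0 then ∑ ij ∈ antidiagonal (-zexp1u σA β).toNat, tay1A σA β ij.1 • topA σA W ij.2 0 else 0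

include hEu hoA in
omit [DecidableEq α] in
/-- The exponent at `1⁻` is uniform. [folklore] -/
theorem zexp1_eq (β : GB α) (r : D) : zexp1 (σat σA r) β = zexp1u σA β := by
  cases β with
  | pow k => rfl
  | invPow k => rfl
  | invLet a k =>
    simp only [zexp1, zexp1u]
    by_cases ha : σA a = 1
    · rw [if_pos ha, if_pos (show σat σA r a = 1 by show σA a r = 1; rw [ha]; rfl)]
    · rw [if_neg ha, if_neg (show ¬(σat σA r a = 1) from fun h => ha ((eqA_one_iff hEu hoA a r).1 h))]

include hEu hoA in
/-- **The mirror evaluates to the regularised values at `1⁻`.** [folklore] -/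
theorem evT_val1A {r : D} (hz : (σat σA r) z = 0) (hσz : ∀ c, c ≠ z → 1 ≤ (σat σA r) c) (β : GB α) (W : List α) :
    val1 hz hσz β W = evT hz hσz r (val1A σA β W) := by
  unfold val1 val1A
  rw [zexp1_eq hEu hoA β r]
  split_ifs
  · rw [evT_finset_sum]
    refine Finset.sum_congr rfl fun ij _ => ?_
    rw [evT_smul, ← evT_topA hEu hoA hz hσz]
    rfl
  · rw [evT_zero]

include hEu hoA hGdiff in
omit [DecidableEq α] in
/-- The Taylor coefficients at `1⁻` are in `𝒢`. [folklore] -/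
theorem tay1A_mem {β : GB α} (hβ : GB.ok σA β) (i : ℕ) : tay1A σA β i ∈ 𝒢 := by
  unfold tay1A
  cases β with
  | pow k =>
    exact powTaylor_mem 𝒢 (ψ := fun _ => oneSubTaylor) (fun i => by
      refine const_mem_of_isRat 𝒢 ?_
      unfold oneSubTaylor; exact isRat_one.ite (isRat_one.neg.ite isRat_zero)) k i
  | invPow k => exact powTaylor_mem 𝒢 (ψ := fun _ _ => (1 : ℝ)) (fun i => Subalgebra.one_mem _) (k + 1) i
  | invLet a k =>
    by_cases ha : σA a = 1
    · have : (fun r => tay1 (σat σA r) (GB.invLet a k) i) = fun _ => if i = 0 then (1 : ℝ) else 0 := by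
        funext r; simp only [tay1]; rw [if_pos (show σat σA r a = 1 by show σA a r = 1; rw [ha]; rfl)]
      rw [this]; split_ifs
      · exact Subalgebra.one_mem _
      · exact Subalgebra.zero_mem _
    · have hne : ∀ r, σA a r ≠ 1 := fun r h => ha ((eqA_one_iff hEu hoA a r).1 h)
      have hao : σA a ≠ σA o := fun h => ha (by rw [h, hoA])
      have : (fun r => tay1 (σat σA r) (GB.invLet a k) i) =
          fun r => powTaylor (fun i => (-1) ^ i / (σA a r - 1) ^ (i + 1)) (k + 1) i := by
        funext r; simp only [tay1]; rw [if_neg (show ¬(σat σA r a = 1) from hne r)]; rfl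
      rw [this]
      refine powTaylor_mem 𝒢 (ψ := fun r i => (-1) ^ i / (σA a r - 1) ^ (i + 1)) (fun i => ?_) (k + 1) i
      have : (fun r => (-1 : ℝ) ^ i / (σA a r - 1) ^ (i + 1)) = fun r => (((-1 : ℚ) ^ i : ℚ) : ℝ) * (((σA a - σA o)⁻¹) ^ (i + 1)) r := by
        funext r
        have ho1 : σA o r = 1 := by rw [hoA]; rfl
        simp [ho1, div_eq_mul_inv, inv_pow]
      rw [this]
      exact ratCast_mul_mem 𝒢 _ (Subalgebra.pow_mem _ (hGdiff o a hao) _)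

include hZu hEu hoA hGdiff in
/-- **The coefficients of the mirror of the regularised values at `1⁻` are in `𝒢`.** [folklore] -/
theorem coefIn_val1A {β : GB α} (hβ : GB.ok σA β) (W : List α) : CoefIn 𝒢 (val1A σA β W) := by
  unfold val1A
  split_ifs
  · exact coefIn_finset_sum 𝒢 _ fun ij _ => (coefIn_topA hZu hoA 𝒢 hGdiff W ij.2 0).smul 𝒢 (tay1A_mem hEu hoA 𝒢 hGdiff hβ ij.1)
  · exact coefIn_zero 𝒢

/-- Words in the support of `val1A` are suffixes of the word. [folklore] -/
theorem suffix_of_mem_support_val1A (β : GB α) (W : List α) (V : List α) (hV : V ∈ (val1A σA β W).support) : V <:+ W := by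
  classical
  unfold val1A at hV
  split_ifs at hV
  · obtain ⟨ij, -, hij⟩ := Finset.mem_biUnion.1 (Finsupp.support_finsetSum hV)
    exact suffix_of_mem_support_topA W ij.2 0 V (Finsupp.support_smul hij)
  · simp at hV

end FamilyTop

/-! ### Word lengths in the primitives -/

section GMaxLen

variable [DecidableEq α] {K : Type*} [CommRing K] [Inv K] {σ : α → K} {z : α}

/-- The maximal word length of an element of the class. [folklore] -/
def maxLenG (F : GH α →₀ K) : ℕ := F.support.sup fun x => x.2.length

omit [DecidableEq α] [Inv K] in
/-- Word lengths are bounded by `maxLenG`. [folklore] -/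
theorem length_le_maxLenG {F : GH α →₀ K} {x : GH α} (hx : x ∈ F.support) : x.2.length ≤ maxLenG F :=
  Finset.le_sup (f := fun x : GH α => x.2.length) hx

/-- Word lengths in `primBG β W` are at most `|W| + 1`. [folklore] -/
theorem length_le_of_mem_support_primBG : ∀ (W : List α) (β : GB α) (x : GH α),
    x ∈ (primBG σ z β W).support → x.2.length ≤ W.length + 1 := by
  classical
  have hrec : ∀ (W : List α) (f : GB α →₀ K),
      (∀ γ x, x ∈ (primBG σ z γ W).support → x.2.length ≤ W.length + 1) →
      ∀ x, x ∈ (f.sum fun γ m => m • primBG σ z γ W).support → x.2.length ≤ W.length + 1 := by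
    intro W f IH x hx
    have hx' := Finsupp.support_finsetSum hx
    simp only [Finset.mem_biUnion] at hx'
    obtain ⟨γ, -, hγ⟩ := hx'
    exact IH γ x (Finsupp.support_smul hγ)
  have hsingle : ∀ (y x : GH α) (q : K), x ∈ (Finsupp.single y q).support → x = y :=
    fun y x q hx => Finset.mem_singleton.1 (Finsupp.support_single_subset hx)
  intro W
  induction W with
  | nil =>
    intro β x hx
    cases β with
    | pow k => rw [hsingle _ _ _ hx]; simp
    | invPow k =>
      cases k with
      | zero => rw [hsingle _ _ _ hx]; simp
      | succ k => rw [hsingle _ _ _ hx]; simp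
    | invLet a k =>
      cases k with
      | zero => rw [hsingle _ _ _ hx]; simp
      | succ k => rw [hsingle _ _ _ hx]; simp
  | cons c W IHW =>
    intro β x hx
    have IH : ∀ γ x, x ∈ (primBG σ z γ W).support → x.2.length ≤ W.length + 1 := fun γ x hx => IHW γ x hx
    have hcase : ∀ (y : GH α) (q r : K) (f : GB α →₀ K), y.2.length ≤ (c :: W).length + 1 →
        x ∈ (Finsupp.single y q + r • f.sum (fun γ m => m • primBG σ z γ W)).support →
        x.2.length ≤ (c :: W).length + 1 := by
      intro y q r f hy hx
      rcases Finset.mem_union.1 (Finsupp.support_add hx) with h | h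
      · rw [hsingle _ _ _ h]; exact hy
      · have := hrec W f IH x (Finsupp.support_smul h)
        simp only [List.length_cons]; omega
    cases β with
    | pow k =>
      refine hcase (GB.pow (k + 1), c :: W) ((k + 1 : K)⁻¹) (-(k + 1 : K)⁻¹) (mulG σ (GB.pow (k + 1)) c) (by simp) ?_
      rw [neg_smul, ← sub_eq_add_neg]; exact hx
    | invPow k =>
      cases k with
      | zero => rw [hsingle _ _ _ hx]; simp
      | succ k =>
        exact hcase (GB.invPow k, c :: W) (-(k + 1 : K)⁻¹) ((k + 1 : K)⁻¹) (mulG σ (GB.invPow k) c) (by simp) hx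
    | invLet a k =>
      cases k with
      | zero => rw [hsingle _ _ _ hx]; simp
      | succ k =>
        refine hcase (GB.invLet a k, c :: W) ((k + 1 : K)⁻¹) (-(k + 1 : K)⁻¹) (mulG σ (GB.invLet a k) c) (by simp) ?_
        rw [neg_smul, ← sub_eq_add_neg]; exact hx

/-- `maxLenG (primG F) ≤ maxLenG F + 1`. [folklore] -/
theorem maxLenG_primG_le (F : GH α →₀ K) : maxLenG (primG σ z F) ≤ maxLenG F + 1 := by
  classical
  refine Finset.sup_le fun x hx => ?_
  unfold primG at hx
  have hx' := Finsupp.support_finsetSum hx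
  simp only [Finset.mem_biUnion] at hx'
  obtain ⟨y, hy, hyx⟩ := hx'
  have h1 := length_le_of_mem_support_primBG y.2 y.1 x (Finsupp.support_smul hyx)
  have h2 := length_le_maxLenG hy
  omega

end GMaxLen

/-! ### Theorem F₁ for families: the integral as a `𝒢`-combination of the values at `1` -/

section FamilyIntegral

open Finset

variable [Fintype α] [DecidableEq α] {D : Type*} {σA : α → D → ℝ} (z o : α)
  (hZu : ∀ c, σA c = 0 ∨ ∀ r, σA c r ≠ 0) (hEu : ∀ a c, σA c = σA a ∨ ∀ r, σA c r ≠ σA a r)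
  (hoA : σA o = 1)
  (𝒢 : Subalgebra ℚ (D → ℝ))
  (hGσ : ∀ a, σA a ∈ 𝒢) (hGinv : ∀ a, σA a ≠ 0 → (σA a)⁻¹ ∈ 𝒢)
  (hGdiff : ∀ a c, σA c ≠ σA a → (σA c - σA a)⁻¹ ∈ 𝒢)

/-- Expansion of a combination of the `regTop V = Z_V` into the values `L_w(1)` through the
shuffle regularisation `reg_{z,o} V`. [folklore] -/
def assocA (z o : α) (v : List α →₀ (D → ℝ)) : List α →₀ (D → ℝ) :=
  v.sum fun V g => (Shuffle.reg z o V).sum fun w q => Finsupp.single w ((q : ℝ) • g)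

/-- **The output expansion**: the coefficients of the values `L_w(1; σ_r)` in
`∫₀¹ hevG(σ_r) (F r)`. [folklore] -/
def outA (σA : α → D → ℝ) (z o : α) (F : GH α →₀ (D → ℝ)) : List α →₀ (D → ℝ) :=
  (primG σA z F).sum fun x g =>
    assocA z o (g • val1A σA x.1 x.2) - Finsupp.single [] (g * fun r => val0 (σat σA r) z x.1 x.2)

/-- Evaluation of an expansion in the values at `1` at a parameter. [folklore] -/
def evH (σ : α → ℝ) (r : D) (v : List α →₀ (D → ℝ)) : ℝ := v.sum fun w g => g r * hlogAt1 σ w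

section evH_lemmas
variable (σ : α → ℝ) (r : D)

omit [Fintype α] [DecidableEq α] in
/-- `evH` of a single. [folklore] -/
@[simp] theorem evH_single (w : List α) (g : D → ℝ) : evH σ r (Finsupp.single w g) = g r * hlogAt1 σ w := by
  unfold evH; rw [Finsupp.sum_single_index]; simp

omit [Fintype α] [DecidableEq α] in
/-- `evH` is additive. [folklore] -/
theorem evH_add (v w : List α →₀ (D → ℝ)) : evH σ r (v + w) = evH σ r v + evH σ r w := by
  unfold evH; rw [Finsupp.sum_add_index'] <;> intros <;> simp [add_mul]

omit [Fintype α] [DecidableEq α] in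
/-- `evH 0 = 0`. [folklore] -/
@[simp] theorem evH_zero : evH σ r (0 : List α →₀ (D → ℝ)) = 0 := by simp [evH]

omit [Fintype α] [DecidableEq α] in
/-- `evH` as an additive homomorphism. [folklore] -/
def evHHom : (List α →₀ (D → ℝ)) →+ ℝ where
  toFun := evH σ r
  map_zero' := evH_zero σ r
  map_add' := evH_add σ r

omit [Fintype α] [DecidableEq α] in
/-- `evH` of a difference. [folklore] -/
theorem evH_sub (v w : List α →₀ (D → ℝ)) : evH σ r (v - w) = evH σ r v - evH σ r w := map_sub (evHHom σ r) v w

omit [Fintype α] [DecidableEq α] in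
/-- `evH` and multiples. [folklore] -/
theorem evH_smul (g : D → ℝ) (v : List α →₀ (D → ℝ)) : evH σ r (g • v) = g r * evH σ r v := by
  unfold evH
  rw [Finsupp.sum_smul_index' (fun _ => by simp)]
  simp only [Finsupp.sum, Finset.mul_sum, Pi.smul_apply', smul_eq_mul, mul_assoc]

omit [Fintype α] [DecidableEq α] in
/-- `evH` of a `Finsupp.sum`. [folklore] -/
theorem evH_finsupp_sum {X N : Type*} [Zero N] (f : X →₀ N) (h : X → N → List α →₀ (D → ℝ)) :
    evH σ r (f.sum h) = f.sum fun x n => evH σ r (h x n) := map_finsuppSum (evHHom σ r) f h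

end evH_lemmas

omit [Fintype α] in
/-- Evaluation of `assocA`: `Σ_V g_V(r) Z_V(σ_r)`. [folklore] -/
theorem evH_assocA (σ : α → ℝ) (r : D) (v : List α →₀ (D → ℝ)) :
    evH σ r (assocA z o v) = v.sum fun V g => g r * genAssoc σ z o V := by
  unfold assocA
  rw [evH_finsupp_sum]
  refine Finsupp.sum_congr fun V _ => ?_
  rw [evH_finsupp_sum, genAssoc, Shuffle.pair]
  simp only [evH_single, Pi.smul_apply, smul_eq_mul, Finsupp.sum, Finset.mul_sum]
  refine Finset.sum_congr rfl fun w _ => ?_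
  rw [Rat.smul_def]; ring

include hZu hEu hoA in
/-- **Theorem F₁ for families.** For a family element `F` with admissible basis functions, at every
parameter `r` where the alphabet `σ_r` is admissible (`σ_r z = 0`, the other letters `≥ 1`, `o` the
only letter at `1`) and the slice `hevG(σ_r)(F r)` is integrable on `(0,1)`:
`∫₀¹ hevG(σ_r)(F r) = Σ_w (outA F)_w(r) · L_w(1; σ_r)`. [cite: BrownENS2009, §6.3–6.5 (Thm 6.25, restriction to faces)] -/
theorem integral_hevG_family {F : GH α →₀ (D → ℝ)} (hF : GH.ok σA F) (hZ' : ∀ a, σA a ≠ 0 → ∀ r, σA a r ≠ 0)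
    {r : D} (hz : σat σA r z = 0) (hσz : ∀ c, c ≠ z → 1 ≤ σat σA r c) (ho : σat σA r o = 1)
    (hσo : ∀ c, c ≠ o → σat σA r c ≠ 1)
    (hint : IntegrableOn (hevG (σat σA r) z (evF r F)) (Ioo 0 1) volume) :
    ∫ t in Ioo (0 : ℝ) 1, hevG (σat σA r) z (evF r F) t = evH (σat σA r) r (outA σA z o F) := by
  classical
  rw [integral_hevG_eq hz hσz (ok_evF hF hZ' r) hint, ← evF_primG (z := z) hZu hEu r F]
  set P := primG σA z F with hP
  -- both sides as sums over the support of `P`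
  have hL : reg1G hz hσz (evF r P) - reg0G (σat σA r) z (evF r P) =
      ∑ x ∈ P.support, (P x r * val1 hz hσz x.1 x.2 - P x r * val0 (σat σA r) z x.1 x.2) := by
    unfold reg1G reg0G evF
    rw [Finsupp.mapRange.addMonoidHom_apply, Finsupp.sum_mapRange_index (fun _ => by simp),
      Finsupp.sum_mapRange_index (fun _ => by simp)]
    simp only [Finsupp.sum, Finset.sum_sub_distrib]
    rfl
  have hR : evH (σat σA r) r (outA σA z o F) =
      ∑ x ∈ P.support, (P x r * val1 hz hσz x.1 x.2 - P x r * val0 (σat σA r) z x.1 x.2) := by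
    unfold outA
    rw [evH_finsupp_sum]
    simp only [Finsupp.sum]
    refine Finset.sum_congr rfl fun x _ => ?_
    rw [evH_sub, evH_assocA, evH_single, hlogAt1_nil (adm_of_zero_letter _ hz hσz), mul_one]
    congr 1
    -- the `val1` part
    rw [evT_val1A hEu hoA hz hσz x.1 x.2]
    unfold evT
    rw [Finsupp.sum_smul_index' (fun _ => by simp)]
    simp only [Finsupp.sum, Finset.mul_sum, Pi.smul_apply', smul_eq_mul]
    refine Finset.sum_congr rfl fun V _ => ?_
    rw [regTop_eq_genAssoc hz hσz ho hσo]
    ring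
  rw [hL, hR]

include hZu hEu hoA hGσ hGinv hGdiff in
omit [Fintype α] in
/-- **The output coefficients lie in `𝒢`.** [folklore] -/
theorem coefIn_outA {F : GH α →₀ (D → ℝ)} (hF : GH.ok σA F) (hFc : CoefIn 𝒢 F) : CoefIn 𝒢 (outA σA z o F) := by
  classical
  unfold outA
  rw [Finsupp.sum]
  refine coefIn_finset_sum 𝒢 _ fun x hx => ?_
  have hPx : primG σA z F x ∈ 𝒢 := coefIn_primG z 𝒢 hGσ hGinv hGdiff hF hFc x
  have hok : GB.ok σA x.1 := primG_ok hF x hx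
  refine CoefIn.sub 𝒢 ?_ (coefIn_single 𝒢 _ (Subalgebra.mul_mem _ hPx (val0_mem z hZu 𝒢 hGinv hok x.2)))
  unfold assocA
  refine coefIn_finsupp_sum 𝒢 ((coefIn_val1A hZu hEu hoA 𝒢 hGdiff hok x.2).smul 𝒢 hPx) fun V g hg => ?_
  rw [Finsupp.sum]
  refine coefIn_finset_sum 𝒢 _ fun w _ => coefIn_single 𝒢 _ ?_
  have : ((Shuffle.reg z o V w : ℚ) : ℝ) • g = fun r => ((Shuffle.reg z o V w : ℚ) : ℝ) * g r := by
    funext r; simp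
  rw [this]
  exact ratCast_mul_mem 𝒢 _ hg

omit [Fintype α] in
/-- **The words of the output**: of length `≤ maxLenG F + 1`, and either empty or in the support
of a shuffle regularisation `reg_{z,o} V` (hence doubly regular). [folklore] -/
theorem outA_support {F : GH α →₀ (D → ℝ)} {w : List α} (hw : w ∈ (outA σA z o F).support) :
    w.length ≤ maxLenG F + 1 ∧ (w = [] ∨ ∃ V, w ∈ (Shuffle.reg z o V).support) := by
  classical
  unfold outA at hw
  obtain ⟨x, hx, hxw⟩ := Finset.mem_biUnion.1 (Finsupp.support_finsetSum hw)
  have hlenx : x.2.length ≤ maxLenG F + 1 := (length_le_maxLenG hx).trans (maxLenG_primG_le F)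
  dsimp only at hxw
  rw [sub_eq_add_neg] at hxw
  rcases Finset.mem_union.1 (Finsupp.support_add hxw) with h | h
  · unfold assocA at h
    obtain ⟨V, hV, hVw⟩ := Finset.mem_biUnion.1 (Finsupp.support_finsetSum h)
    obtain ⟨w', hw', hw'w⟩ := Finset.mem_biUnion.1 (Finsupp.support_finsetSum hVw)
    have hww' : w = w' := Finset.mem_singleton.1 (Finsupp.support_single_subset hw'w)
    subst hww'
    have hVsuf : V <:+ x.2 := suffix_of_mem_support_val1A x.1 x.2 V (Finsupp.support_smul hV)
    refine ⟨?_, Or.inr ⟨V, hw'⟩⟩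
    rw [Shuffle.length_eq_of_mem_support_reg z o V hw']
    exact hVsuf.length_le.trans hlenx
  · rw [Finsupp.support_neg] at h
    have : w = [] := Finset.mem_singleton.1 (Finsupp.support_single_subset h)
    exact ⟨by rw [this]; simp, Or.inl this⟩

end FamilyIntegral

end Hyperlog

end Literature.NumberTheory.Transcendental
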